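import Literature.MathematicalPhysics.QuantumFieldTheory.Balaban1983to89.B9Ineq346L2SecondDiff

/-!
# `Balaban1983to89.B9Ineq346L2RightDiff` — [Balaban1985BackgroundPropagators] THEOREM 3.4 p. 400 × THEOREM 3.1 (3.46)₆ p. 398:
# THE `L²` MEMBER WITH TWO RIGHT DIFFERENCES («‖hG′(U)∇*_U∇*_Uλ‖ ≦ B₀·1·|h|e^{−δ₀d(y,y′)}‖λ‖») FOR THE EXTENDED OPERATOR `G′(U′U)` (3.64), AT THE
# FINAL LEVEL — from (3.46)₆ FOR `U` (an `L²` block input), the second equality of (3.65), a KERNEL bound for `G′(U′U)·V′(A)` with `V′(A)` ON THE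
# RIGHT (divergence form of the concrete `V′(A)` + a column (`ℓ¹`) calculus for its local letters — the transposed reading of [4] (2.51)–(2.52)),
# Minkowski and FILE 39's Schur step; FILE 41 of the Sect. B programme of cell `lit-balaban`, seat r06 gen 19; closes GAPS G-B9-02 for `G′(U′U)`

statement-level skeleton of published theorems with citation tags; proofs where landed; nothing here is a claim about the Yang–Mills mass gap

CITATION HEADER (lean-in-tree rule).  B9 = T. Bałaban, *Propagators for lattice gauge theories in a background field*, Commun. Math. Phys. **99** (1985)
389–434 [Balaban1985BackgroundPropagators] (doi 10.1007/bf01240355; `paper:balaban1985-cmp99-background-propagators`, journal page = PDF page + 388):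
Theorem 3.1 (3.46) p. 398 [PDF 10] verbatim (page image `inprint/lit-balaban-p05/renders/cmp99b/p10.png`; the text layer p0010 L11–14 is degraded):
«Finally, we have the inequalities in L²-norms ‖hG′(U)λ‖, ‖h∇_UG′(U)λ‖, ‖hG′(U)∇*_Uλ‖, ‖h∇_U∇_UG′(U)λ‖, ‖h∇_UG′(U)∇*_Uλ‖, ‖hG′(U)∇*_U∇*_Uλ‖ ≦
B₀[(Lʲη)², Lʲη, Lʲη, 1, 1, 1]|h|e^{−δ₀d(y,y′)}‖λ‖ for supp h ⊂ Δ(y), y ∈ Λ_j, supp λ ⊂ Δ(y′); (3.46)» — this file: the SIXTH member (weight `1`, two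
differences on the RIGHT); p. 398 [PDF 10] L20–24 remarks («At first the choice of derivatives ∇_U, ∇*_U is conventional, we may always replace ∇*_U by
∇_U, and vice versa, in arbitrary place and combination. Next, the choice of powers Lʲη is conventional also. Using Lemma 2.1 in [4] we may replace
the factor (Lʲη)^α by (Lʲη)^β(L^{j′}η)^γ with β + γ = α»); Theorem 3.4 p. 400 [PDF 12] L7–10 («There exists a positive constant a₁ such that the
operators G′(U), (Q′(U)G′²(U)Q′*(U))⁻¹, R(U), G(U) extend to configurations U′U for α₁ ≦ a₁ as analytic functions of A. The extended operators
satisfy all the inequalities of Theorems 3.1–3.3 correspondingly»); (3.60)–(3.61) p. 402 [PDF 14] L17–19 (the perturbation `V′(A)` and «|(V′(A)λ)(x)|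
≦ O(1)α₁((Lʲη)⁻¹|∇_Uλ| + (Lʲη)⁻²|λ|) (3.61)»); (3.65) p. 402 [PDF 14] L37 («G′(U′U) = G′(U) + G′(U)V′(A)G′(U′U) = G′(U) + G′(U′U)V′(A)G′(U), (3.65)» —
THIS FILE USES THE SECOND EQUALITY); p. 403 [PDF 15] L3–9 («Now applying Theorem 3.1 for G′(U), the bound (3.63), the representation (3.64) and
Lemma 2.1 of [4] we can prove all the statements (3.42)–(3.47) of Theorem 3.1 for the operator G′(U′U), of course with different constants … the
remainders G′(U)V′(A)G′(U′U) and G′(U′U)V′(A)G′(U) in (3.65). They satisfy Theorem 3.1 with the additional small factor O(1)α₁»); (3.37) p. 396,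
(3.52) p. 400, (3.19) p. 393, (3.24) p. 394, (3.57)–(3.59) pp. 401–402, p. 393 (kernel pairing).  [4] = T. Bałaban, *Propagators and renormalization
transformations for lattice gauge theories. II*, Commun. Math. Phys. **96** (1984) 223–250 [Balaban1984PropagatorsII], (2.51)–(2.55) p. 232,
(2.64)–(2.66) p. 234, Lemma 2.1 (2.61) p. 234.  [B8] = T. Bałaban, *Spaces of regular gauge field configurations on a lattice and gauge fixing
conditions*, Commun. Math. Phys. **99** (1985) 75–102 [Balaban1985RegularSpaces], (1.87) p. 91 (lattice Leibniz rule).  Cell `lit-balaban`, seat r06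
(B9 fold owner) gen 19, FILE 41; SKELETON rows **B9.Thm3.4** × B9.Thm3.1 ((3.46) cell) × B9.Eq3.62 ((3.65)) × B9.Eq3.60 ((3.60)–(3.61)) (cells); no row
head changes.

WHY THIS FILE (B9-CLOSURE §5 item 3 (O″)).  After FILES 39/40 every local inequality of Theorem 3.1/3.3 for the extended operators was a theorem at the
final level EXCEPT (3.46)₆ `‖hG′∇*_U∇*_Uλ‖` (two differences on the RIGHT).  The member is NOT a consequence of (3.42) (no sup/kernel bound for second
differences is printed), and the FILE 40 route — (3.65)₁ with the perturbation `V′(A)` to the LEFT of the extended operator — does not transfer it: the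
difference letters of `V′(A)` would land on the `L²`-controlled input `G′(U)∇*∇*λ` (three differences).  The SECOND equality of (3.65),
`G′(U′U) = G′(U) + G′(U′U)V′(A)G′(U)`, gives instead `G′(U′U)∇∇ = G′(U)∇∇ + [G′(U′U)V′(A)]·(G′(U)∇∇)`: the right factor carries (3.46)₆ FOR `U` (an
INPUT, `h346`), and the left factor `W = G′(U′U)V′(A)` — `V′(A)` on the RIGHT of a kernel-bounded operator — needs a KERNEL bound.  A block majorant
([4] (2.51), a row/sup bound) of a right letter does NOT give it (the kernel of `T·S` from a sup bound of `S` costs a block volume); what is needed is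
the COLUMN (`ℓ¹`, transposed) bound of the letter, `Σ_{w∈Δ(y″)}|(Sδ_{x′})(w)|`, and the dictionary «kernel × column ⇒ kernel» (§1).  For the concrete
`V′(A)` of (3.60) the columns are available because its letters are explicit lattice operators: in DIVERGENCE form `V′ = Σ_k∇_kV¹_k + C″`,
`C″ = (V⁰ − avgOp) + Σ_k[V¹_k, ∇_k]` (gen 9/16 `conj_vPrimeConc_eq_gradForm` + `B9Ineq386CommSum.divForm_of_gradForm_sum`), the difference letters
`∇_k` attach to `G′(U′U)` as the right kernel entries (3.42)₃ of FILE 16, and the remaining letters — `iad_{A}` (stencil `{x}`), `V⁰` (stencil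
`{x} ∪ st(x)`), the commutator letters `ad_{∇a}∘τ` ([B8] (1.87)) and the block-local averaging part of (3.60) — have column bounds of the SAME sizes
`α₁(Lʲη)⁻¹`, `α₁(Lʲη)⁻²` as their row bounds ((3.61)/(3.37) read entrywise: a stencil letter is hit from at most `1 + 2d` points; the averaging part
has entries `≦ w(y)·α₁(Lʲη)⁻²` with `#B(y)·w(y) ≦ 1`).  Then FILE 39's Schur step and [4] (2.61) as in FILE 40, mirrored (§4).
* §1 (block carrier `X`, generic) `ker_mul_eq_sum_col` (`(TS)(x,x′) = Σ_w T(x,w)(Sδ_{x′})(w)`), `abs_ker_mul_le_of_col`, **`hasKernelBound_mul_col`** (kernel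
  × column ⇒ kernel, with the scale transfers of the column weight and of the block-volume weight `v⁻¹` and [4] (2.61) for the `y″`-sum),
  `hasKernelBound_finset_sum`, `col_mono/add/neg/sub/finset_sum` (the column property is written out as a hypothesis shape; no new definition).
* §2 (carrier `S × ι`, real coordinates `b`) `coordSymm_single`; the column seams **`col_conj_of_dom`** (entrywise domination) and **`col_conj_of_local`**
  (the SAME stencil hypothesis `hT` as `B9Eq352DivFormLetters.hasMajorant_conj_of_local` + a reverse stencil of `≦ n` points); the letters
  `col_mulLetter`, `col_coefLetter`, `col_commLetterF/B`, `col_comm_coefLetter_diffLetter`, `col_V0op`, `kerOp_single`, `col_avgOp`.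
* §3 **`hasKernelBound_mul_vPrime_right`**: `|(T·V′(A))(x,x′)| ≦ Θ·α₁·w_T(y)(Lʲη)⁻²e^{−ρd}v(y′)⁻¹` from the kernel bounds of the right entries `T`, `T∇*_k`
  (weights `w_T`, `w_T(Lʲη)⁻¹`) — the transposed twin of FILE 16's `ineq363_kernel_vPrime` («O(1)B₀α₁», p. 403 l. 7–9, for the SECOND remainder).
* §4 (generic) **`l2_right_transfer`** (`E = T₀ + W·T₀`; mirror image of FILE 40's `l2_left_transfer`), with private Minkowski plumbing.
* §5 **`thm34_Gp_l2_right_final`** — HYPOTHESES = FILE 16 `thm34_Gp_kernel_final` VERBATIM + `hvol`, `hSTv` (as FILES 39/40) + NEW (3.46)₆ FOR `G′(U)` as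
  an `L²` block input for every pair `G′(U)∇_k∇_m` (`h346`); CONCLUSION `∃ a₁ > 0 ∃ B ≧ 0 ∀ α₁ ≦ a₁ ∀ A kF sF …` (FILE 16's premises): the inverse
  identities ∧ `∀ k m y y′ h λ`, `‖h·G′(U′U)∇_k∇_mλ‖₂ ≦ B|h|e^{−(19δ₀/25)d(y,y′)}‖λ‖₂`.

HONEST SCOPE.  (a) Covered: (3.46)₆ (two differences on the RIGHT) for the extended operator `G′(U′U)` of Theorem 3.1 × Theorem 3.4; with FILES 39/40
ALL SIX members of (3.46) for `G′(U′U)` are theorems at the final level.  NOT covered here: (3.46)₆ for the `G(U′U)` of Theorem 3.3 × 3.4 (FILE 28) —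
its perturbation `V(A) = V₃(A) + P₁(A) + P₂(A)` ((3.82)–(3.84)) contains, besides the concrete `V₃(A)` (columns derivable as in §2 from the gen-11
letters), the words `P₁(A)` (3.76) and `P₂(A)` (3.82) built from the averaging letters `Q`, `Q*`, `Q′`, `Q′*`, `F₂`, `F₂*`, `F′₂`, `F′₂*` which FILE 28
takes as ABSTRACT operators with block majorants only; their column bounds are additional data of printed shape ((3.15)/(3.19): one block per fine
point) resp. NOT printed for `F₂(A)` ((3.81) is a sup bound) — open item (O‴) of B9-CLOSURE.  (b) (3.46)₆ FOR `U` enters as an INPUT in `L²` block form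
per pair of concrete first differences on the right (`h346`, constant `B₄₆`, rate `δ₀`), exactly the printed member read in the counting norms of the
real coordinates (both orientations of `∇`, p. 398 remark); it is NOT derived here ([4]'s `L²` regularity, Theorem 3.1's own content).  (c) Norms,
`|h|`, `hvol`, `hSTv` as in FILE 39 (c), (d): counting `ℓ²` norms of the real coordinates; the kernel pairing weight `c = η^d` and block volumes
`v(y) = (Lʲη)^d` enter only through `hvol` and the scale transfer of `v^{−1/2}` ([4] Lemma 2.1, p. 398 remark) — used here also SQUARED, for `v⁻¹` at
the rate `δ₀/50`.  (d) Rate `19δ₀/25` (cascade `δ₀ →` FILE 16 `4δ₀/5 → 39δ₀/50 → 77δ₀/100 → 19δ₀/25`); «different constants»: the `α₁`-dependent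
`Θ(α₁)` of §3 is bounded by a constant below a threshold by continuity at `α₁ = 0` (`exists_bound_of_continuousAt`), `a₁ = min(a₁⁽¹⁶⁾, ε/2, 1/4)`.
(e) No new definition, no named fact, no row head change (B9.Thm3.4 stays `typed-existing`: Theorems 3.1–3.3 for a general `U` are inputs).
(f) The column calculus is bookkeeping of ours (the transposed reading of [4] (2.51)–(2.52)); print treats the `L²` members as «routine» (p. 403, p. 407).

Depends on: `B9Ineq346L2SecondDiff` (FILE 40; transitively FILE 39 `l2_block_of_kernelBound_transfer`, FILE 37 `resolvent_right`), `B9Thm34GpKernelFinal`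
(FILE 16: `thm34_Gp_kernel_final`), `B9Thm34GKernelFinal` (`exists_bound_of_continuousAt`), `B9Eq360VprimeLetters` (`vPrimeConc`, `avgOp_apply`,
`conj_vPrimeConc_eq_gradForm`), `B9Eq360Vprime` (`kerOp`, `block`, `gPrimeExtEnd`), `B9Eq352GradLetters` (`V0op`, `coefLetter`, `diffLetter`,
`norm_V0op_le_printed`), `B9Eq352DivFormLetters` (`coordEquiv`, `conj`, `mulLetter`, `commLetterF/B`, `mul_grad_comm_F/B`, `norm_commLetterF/B_le`),
`B9Ineq386CommSum` (`divForm_of_gradForm_sum`), `B9Ineq366CPrime` (`conv_le`, `scaleTransfer_one`), `B9Ineq385Kernel` (`exp_rate_mono`),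
`B6RandomWalkKernel` (`ker`, `apply_single_eq`, `apply_eq_sum_single`, `ker_mul_apply`, `HasKernelBound`, `hasKernelBound_mono/add`), `B6RandomWalk`
(`blockPiece`, `sum_blockPiece`, `Ineq261`, `Triangle254`), `B9Ineq347` (`ScaleTransfer`), `Beta.BackgroundVertices` (`ad`, `norm_ad_le`), Mathlib
`EuclideanSpace.norm_eq`, `norm_add_le`, `Finset.sum_fiberwise_of_maps_to` — all used BY NAME.
-/

noncomputable section

namespace Literature.MathematicalPhysics.QuantumFieldTheory.Balaban1983to89.B9Ineq346L2RightDiff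

open NormedSpace Complex
open Literature.MathematicalPhysics.QuantumFieldTheory.Balaban1983to89
open Literature.MathematicalPhysics.QuantumFieldTheory.Balaban1983to89.B6RandomWalk (HasMajorant BlockSupp blockPiece sum_blockPiece hasMajorant_mono Triangle254 Ineq261)
open Literature.MathematicalPhysics.QuantumFieldTheory.Balaban1983to89.B6RandomWalkKernel (ker apply_single_eq apply_eq_sum_single ker_mul_apply HasKernelBound hasKernelBound_mono hasKernelBound_add)
open Literature.MathematicalPhysics.QuantumFieldTheory.Balaban1983to89.B9Thm34Ext (toB6)
open Literature.MathematicalPhysics.QuantumFieldTheory.Balaban1983to89.B9Ineq347 (ScaleTransfer)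
open Literature.MathematicalPhysics.QuantumFieldTheory.Balaban1983to89.B9Ineq385Kernel (exp_rate_mono)
open Literature.MathematicalPhysics.QuantumFieldTheory.Balaban1983to89.B9Ineq366CPrime (conv_le scaleTransfer_one)
open Literature.MathematicalPhysics.QuantumFieldTheory.Balaban1983to89.Beta.BackgroundVertices (ad norm_ad_le)
open Literature.MathematicalPhysics.QuantumFieldTheory.Balaban1983to89.B9Eq39Adjoint
open Literature.MathematicalPhysics.QuantumFieldTheory.Balaban1983to89.B9Eq352DivForm (tauF tauB tauF_apply tauB_apply)
open Literature.MathematicalPhysics.QuantumFieldTheory.Balaban1983to89.B9Eq352DivFormLetters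
open Literature.MathematicalPhysics.QuantumFieldTheory.Balaban1983to89.B9Eq352GradLetters (V0op coefLetter diffLetter coefLetter_inl coefLetter_inr
  diffLetter_inl diffLetter_inr norm_V0op_le_printed)
open Literature.MathematicalPhysics.QuantumFieldTheory.Balaban1983to89.B9Eq360Vprime (kerOp liftOp diagOp kerOp_apply liftOp_apply diagOp_apply block mem_block)
open Literature.MathematicalPhysics.QuantumFieldTheory.Balaban1983to89.B9Eq360VprimeLetters (vPrimeConc avgOp_apply conj_vPrimeConc_eq_gradForm)
open Literature.MathematicalPhysics.QuantumFieldTheory.Balaban1983to89.B9Eq360Vprime (gPrimeExtEnd)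
open Literature.MathematicalPhysics.QuantumFieldTheory.Balaban1983to89.B9Ineq346L2Final (l2_block_of_kernelBound_transfer)
open Literature.MathematicalPhysics.QuantumFieldTheory.Balaban1983to89.B9Thm34GKernelFinal (exists_bound_of_continuousAt)
open Literature.MathematicalPhysics.QuantumFieldTheory.Balaban1983to89.B9Thm34GpKernelFinal (thm34_Gp_kernel_final)
open Literature.MathematicalPhysics.QuantumFieldTheory.Balaban1983to89.B9Thm34HolderInputG (resolvent_right)

/-! ## §1  Column (`ℓ¹`) bounds of a right letter and the kernel of `T·S` — the transposed reading of [4] (2.51)–(2.52) -/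

section Col

variable {g : B9.Geometry} [Fintype g.Site] [DecidableEq g.Site] {R : ℝ} {H : Prop} {X : Type} [Fintype X] [DecidableEq X]

/-- **The kernel of a product against the COLUMN of the right letter** ([4] (2.52) read on the right factor): `(TS)(x,x′) = Σ_w T(x,w)·(Sδ_{x′})(w)`
(pairing weight `c`; `ker c T x w = c⁻¹(Tδ_w)(x)`). [cite: Balaban1984PropagatorsII, (2.52) p.232; Balaban1985BackgroundPropagators, p.393 (bookkeeping ours)] -/
theorem ker_mul_eq_sum_col {c : ℝ} (hc : c ≠ 0) (T S : Module.End ℝ (X → ℝ)) (x x' : X) :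
    ker c (T * S) x x' = ∑ w : X, ker c T x w * S (Pi.single x' 1) w := by
  rw [ker_mul_apply, apply_eq_sum_single T (S (Pi.single x' 1)) x, Finset.mul_sum]
  refine Finset.sum_congr rfl fun w _ => ?_
  rw [apply_single_eq hc T x w]
  field_simp

/-- **KERNEL × COLUMN BOUND ⇒ KERNEL BOUND, raw form.**  If `|T(x,w)| ≦ K_T(y,y″)v(y″)⁻¹` (`w ∈ Δ(y″)`, [4] (2.64)–(2.66) shape) and the right letter `S`
has the COLUMN bound `Σ_{w∈Δ(y″)}|(Sδ_{x′})(w)| ≦ K_S(y″,y′)` (`x′ ∈ Δ(y′)`; the transposed reading of the block majorant (2.51)), then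
`|(TS)(x,x′)| ≦ Σ_{y″}K_T(y,y″)v(y″)⁻¹K_S(y″,y′)` (insert `Σ_{y″}Δ(y″) = I` between the factors, (2.52)).
[cite: Balaban1984PropagatorsII, (2.51)–(2.52) p.232 + (2.64)–(2.66) p.234 (bookkeeping ours)] -/
theorem abs_ker_mul_le_of_col (blk : X → g.Site) {v : g.Site → ℝ} (hv : ∀ y, 0 < v y) {c : ℝ} (hc : 0 < c)
    {T S : Module.End ℝ (X → ℝ)} {KT KS : g.Site → g.Site → ℝ} (hKT : ∀ a a', 0 ≤ KT a a')
    (hT : HasKernelBound (g := toB6 g R H) blk v c T KT)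
    (hS : ∀ (x' : X) (y'' : g.Site), (∑ z ∈ Finset.univ.filter (fun z : X => blk z = y''), |S (Pi.single x' 1) z|) ≤ KS y'' (blk x'))
    (x x' : X) :
    |ker c (T * S) x x'| ≤ ∑ y'' : g.Site, KT (blk x) y'' * (v y'')⁻¹ * KS y'' (blk x') := by
  classical
  rw [ker_mul_eq_sum_col hc.ne']
  -- pointwise: `|T(x,w)(Sδ_{x′})(w)| ≦ K_T(y, y_w)v(y_w)⁻¹|(Sδ_{x′})(w)|`
  have hterm : ∀ w : X, |ker c T x w * S (Pi.single x' 1) w| ≤ KT (blk x) (blk w) * (v (blk w))⁻¹ * |S (Pi.single x' 1) w| := by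
    intro w
    rw [abs_mul]
    exact mul_le_mul_of_nonneg_right (hT x w) (abs_nonneg _)
  -- regroup the `w`-sum by blocks
  have hfib : ∑ w : X, KT (blk x) (blk w) * (v (blk w))⁻¹ * |S (Pi.single x' 1) w| =
      ∑ y'' : g.Site, ∑ w ∈ Finset.univ.filter (fun z : X => blk z = y''), KT (blk x) y'' * (v y'')⁻¹ * |S (Pi.single x' 1) w| := by
    rw [← Finset.sum_fiberwise_of_maps_to (g := blk) (t := (Finset.univ : Finset g.Site)) (fun w _ => Finset.mem_univ _)]
    refine Finset.sum_congr rfl fun y'' _ => Finset.sum_congr rfl fun w hw => ?_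
    rw [(Finset.mem_filter.mp hw).2]
  calc |∑ w : X, ker c T x w * S (Pi.single x' 1) w|
      ≤ ∑ w : X, |ker c T x w * S (Pi.single x' 1) w| := Finset.abs_sum_le_sum_abs _ _
    _ ≤ ∑ w : X, KT (blk x) (blk w) * (v (blk w))⁻¹ * |S (Pi.single x' 1) w| := Finset.sum_le_sum fun w _ => hterm w
    _ = ∑ y'' : g.Site, ∑ w ∈ Finset.univ.filter (fun z : X => blk z = y''), KT (blk x) y'' * (v y'')⁻¹ * |S (Pi.single x' 1) w| := hfib
    _ = ∑ y'' : g.Site, KT (blk x) y'' * (v y'')⁻¹ * ∑ w ∈ Finset.univ.filter (fun z : X => blk z = y''), |S (Pi.single x' 1) w| := by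
        refine Finset.sum_congr rfl fun y'' _ => ?_
        rw [Finset.mul_sum]
    _ ≤ ∑ y'' : g.Site, KT (blk x) y'' * (v y'')⁻¹ * KS y'' (blk x') :=
        Finset.sum_le_sum fun y'' _ => mul_le_mul_of_nonneg_left (hS x' y'') (mul_nonneg (hKT _ _) (inv_nonneg.mpr (hv _).le))

/-- **KERNEL × COLUMN BOUND ⇒ KERNEL BOUND, decaying shape with the scale transfers.**  `T` with the kernel bound `A_Tw₁(y)e^{−rd(y,y″)}v(y″)⁻¹`, the
right letter `S` with the column bound `A_Sw₂(y″)e^{−(ρ+γ)d(y″,y′)}`; the block-volume weight is moved from `y″` to `y′` by `e^{−γd(y″,y′)}v(y″)⁻¹ ≦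
Λ_vv(y′)⁻¹` (p. 398 remark: [4] Lemma 2.1 for the weight `(L^{j}η)^{−d}`), `w₂` from `y″` to `y` at exponent `α`, and the `y″`-sum is [4] (2.61) at `β`
(`ρ + (α+β)δ₀ ≦ r`): `|(TS)(x,x′)| ≦ Λ_vΛc₁A_TA_S·w₁(y)w₂(y)·e^{−ρd(y,y′)}v(y′)⁻¹`.
[cite: Balaban1984PropagatorsII, (2.51)–(2.55) p.232 + Lemma 2.1 (2.61) p.234 + (2.64)–(2.66) p.234; Balaban1985BackgroundPropagators, p.398 remark + p.393 (bookkeeping ours)] -/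
theorem hasKernelBound_mul_col (blk : X → g.Site) {v : g.Site → ℝ} (hv : ∀ y, 0 < v y) {c : ℝ} (hc : 0 < c) (d : ℕ)
    {δ₀ α β γ ρ r Λ Λv AT AS : ℝ} (w₁ w₂ : g.Site → ℝ) (hw₁ : ∀ a, 0 ≤ w₁ a) (hw₂ : ∀ a, 0 ≤ w₂ a)
    (hAT : 0 ≤ AT) (hAS : 0 ≤ AS) (hΛ : 0 ≤ Λ) (hΛv : 0 ≤ Λv) (hρ : 0 ≤ ρ) (hr : ρ + (α + β) * δ₀ ≤ r)
    (hdnn : ∀ a a' : g.Site, 0 ≤ g.dist a a') (htri : Triangle254 (toB6 g R H))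
    (hST : ScaleTransfer g δ₀ α Λ w₂) (h261 : Ineq261 d (toB6 g R H) δ₀ β)
    (hTv : ∀ a b : g.Site, Real.exp (-(γ * g.dist a b)) * (v a)⁻¹ ≤ Λv * (v b)⁻¹)
    {T S : Module.End ℝ (X → ℝ)}
    (hT : HasKernelBound (g := toB6 g R H) blk v c T (fun a a' => AT * w₁ a * Real.exp (-(r * g.dist a a'))))
    (hS : ∀ (x' : X) (y'' : g.Site), (∑ z ∈ Finset.univ.filter (fun z : X => blk z = y''), |S (Pi.single x' 1) z|) ≤
      AS * w₂ y'' * Real.exp (-((ρ + γ) * g.dist y'' (blk x')))) :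
    HasKernelBound (g := toB6 g R H) blk v c (T * S)
      (fun a b => (Λv * Λ * B6.c1 d δ₀ β * AT * AS) * (w₁ a * w₂ a) * Real.exp (-(ρ * g.dist a b))) := by
  intro x x'
  have hraw := abs_ker_mul_le_of_col (R := R) (H := H) blk hv hc (KS := fun y'' b => AS * w₂ y'' * Real.exp (-((ρ + γ) * g.dist y'' b)))
    (fun a a' => mul_nonneg (mul_nonneg hAT (hw₁ a)) (Real.exp_nonneg _)) hT hS x x'
  refine hraw.trans ?_
  -- move `v(y″)⁻¹` to `v(y′)⁻¹` with the factor `e^{−γd(y″,y′)}`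
  have hterm : ∀ y'' : g.Site, AT * w₁ (blk x) * Real.exp (-(r * g.dist (blk x) y'')) * (v y'')⁻¹ *
      (AS * w₂ y'' * Real.exp (-((ρ + γ) * g.dist y'' (blk x')))) ≤
      Λv * (v (blk x'))⁻¹ * (AT * AS) * ((w₁ (blk x) * Real.exp (-(r * g.dist (blk x) y''))) * (w₂ y'' * Real.exp (-(ρ * g.dist y'' (blk x'))))) := by
    intro y''
    have hsplit : Real.exp (-((ρ + γ) * g.dist y'' (blk x'))) = Real.exp (-(ρ * g.dist y'' (blk x'))) * Real.exp (-(γ * g.dist y'' (blk x'))) := by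
      rw [← Real.exp_add]; congr 1; ring
    rw [hsplit]
    have h1 := hTv y'' (blk x')
    have hpre : 0 ≤ AT * AS * (w₁ (blk x) * Real.exp (-(r * g.dist (blk x) y''))) * (w₂ y'' * Real.exp (-(ρ * g.dist y'' (blk x')))) :=
      mul_nonneg (mul_nonneg (mul_nonneg hAT hAS) (mul_nonneg (hw₁ _) (Real.exp_nonneg _))) (mul_nonneg (hw₂ _) (Real.exp_nonneg _))
    calc AT * w₁ (blk x) * Real.exp (-(r * g.dist (blk x) y'')) * (v y'')⁻¹ *
          (AS * w₂ y'' * (Real.exp (-(ρ * g.dist y'' (blk x'))) * Real.exp (-(γ * g.dist y'' (blk x')))))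
        = (AT * AS * (w₁ (blk x) * Real.exp (-(r * g.dist (blk x) y''))) * (w₂ y'' * Real.exp (-(ρ * g.dist y'' (blk x'))))) *
            (Real.exp (-(γ * g.dist y'' (blk x'))) * (v y'')⁻¹) := by ring
      _ ≤ (AT * AS * (w₁ (blk x) * Real.exp (-(r * g.dist (blk x) y''))) * (w₂ y'' * Real.exp (-(ρ * g.dist y'' (blk x'))))) *
            (Λv * (v (blk x'))⁻¹) := mul_le_mul_of_nonneg_left h1 hpre
      _ = Λv * (v (blk x'))⁻¹ * (AT * AS) * ((w₁ (blk x) * Real.exp (-(r * g.dist (blk x) y''))) * (w₂ y'' * Real.exp (-(ρ * g.dist y'' (blk x'))))) := by ring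
  have hconv := conv_le (R := R) (H := H) d δ₀ α β ρ r Λ w₁ w₂ hw₁ hw₂ hΛ hρ hr hdnn htri hST h261 (blk x) (blk x')
  have hpre2 : 0 ≤ Λv * (v (blk x'))⁻¹ * (AT * AS) := mul_nonneg (mul_nonneg hΛv (inv_nonneg.mpr (hv _).le)) (mul_nonneg hAT hAS)
  calc ∑ y'' : g.Site, AT * w₁ (blk x) * Real.exp (-(r * g.dist (blk x) y'')) * (v y'')⁻¹ *
          (AS * w₂ y'' * Real.exp (-((ρ + γ) * g.dist y'' (blk x'))))
      ≤ ∑ y'' : g.Site, Λv * (v (blk x'))⁻¹ * (AT * AS) *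
          ((w₁ (blk x) * Real.exp (-(r * g.dist (blk x) y''))) * (w₂ y'' * Real.exp (-(ρ * g.dist y'' (blk x'))))) :=
        Finset.sum_le_sum fun y'' _ => hterm y''
    _ = Λv * (v (blk x'))⁻¹ * (AT * AS) *
          ∑ y'' : g.Site, (w₁ (blk x) * Real.exp (-(r * g.dist (blk x) y''))) * (w₂ y'' * Real.exp (-(ρ * g.dist y'' (blk x')))) := by
        rw [Finset.mul_sum]
    _ ≤ Λv * (v (blk x'))⁻¹ * (AT * AS) * (Λ * B6.c1 d δ₀ β * (w₁ (blk x) * w₂ (blk x)) * Real.exp (-(ρ * g.dist (blk x) (blk x')))) :=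
        mul_le_mul_of_nonneg_left hconv hpre2
    _ = (Λv * Λ * B6.c1 d δ₀ β * AT * AS) * (w₁ (blk x) * w₂ (blk x)) * Real.exp (-(ρ * g.dist (blk x) (blk x'))) * (v (blk x'))⁻¹ := by ring

omit [DecidableEq g.Site] [Fintype X] in
/-- Kernel bounds of a finite sum of operators add up ([4] p. 232 «A summation preserves it also», kernel member).
[cite: Balaban1984PropagatorsII, (2.55) p.232 (bookkeeping ours)] -/
theorem hasKernelBound_finset_sum {K : Type} (blk : X → g.Site) {v : g.Site → ℝ} {c : ℝ} (s : Finset K)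
    (T : K → Module.End ℝ (X → ℝ)) (Kf : K → g.Site → g.Site → ℝ)
    (h : ∀ k ∈ s, HasKernelBound (g := toB6 g R H) blk v c (T k) (Kf k)) :
    HasKernelBound (g := toB6 g R H) blk v c (∑ k ∈ s, T k) (fun a b => ∑ k ∈ s, Kf k a b) := by
  classical
  induction s using Finset.induction_on with
  | empty =>
      intro x x'
      simp [ker]
  | insert a s ha ih =>
      have h' := hasKernelBound_add (g := toB6 g R H) blk (h a (Finset.mem_insert_self a s)) (ih fun k hk => h k (Finset.mem_insert_of_mem hk))
      intro x x'
      have := h' x x'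
      simpa only [Finset.sum_insert ha] using this

omit [Fintype g.Site] in
/-- Monotonicity of column bounds in the constant. [cite: Balaban1984PropagatorsII, (2.51) p.232 (bookkeeping ours)] -/
theorem col_mono (blk : X → g.Site) {S : Module.End ℝ (X → ℝ)} {K K' : g.Site → g.Site → ℝ}
    (h : ∀ (x' : X) (y'' : g.Site), (∑ z ∈ Finset.univ.filter (fun z : X => blk z = y''), |S (Pi.single x' 1) z|) ≤ K y'' (blk x'))
    (hle : ∀ a b, K a b ≤ K' a b) :
    ∀ (x' : X) (y'' : g.Site), (∑ z ∈ Finset.univ.filter (fun z : X => blk z = y''), |S (Pi.single x' 1) z|) ≤ K' y'' (blk x') :=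
  fun x' y'' => (h x' y'').trans (hle _ _)

omit [Fintype g.Site] in
/-- Column bounds add ([4] p. 232 «A summation preserves it also», transposed member). [cite: Balaban1984PropagatorsII, (2.52)–(2.55) p.232 (bookkeeping ours)] -/
theorem col_add (blk : X → g.Site) {S₁ S₂ : Module.End ℝ (X → ℝ)} {K₁ K₂ : g.Site → g.Site → ℝ}
    (h₁ : ∀ (x' : X) (y'' : g.Site), (∑ z ∈ Finset.univ.filter (fun z : X => blk z = y''), |S₁ (Pi.single x' 1) z|) ≤ K₁ y'' (blk x'))
    (h₂ : ∀ (x' : X) (y'' : g.Site), (∑ z ∈ Finset.univ.filter (fun z : X => blk z = y''), |S₂ (Pi.single x' 1) z|) ≤ K₂ y'' (blk x')) :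
    ∀ (x' : X) (y'' : g.Site), (∑ z ∈ Finset.univ.filter (fun z : X => blk z = y''), |(S₁ + S₂) (Pi.single x' 1) z|) ≤ K₁ y'' (blk x') + K₂ y'' (blk x') := by
  intro x' y''
  calc (∑ z ∈ Finset.univ.filter (fun z : X => blk z = y''), |(S₁ + S₂) (Pi.single x' 1) z|)
      ≤ ∑ z ∈ Finset.univ.filter (fun z : X => blk z = y''), (|S₁ (Pi.single x' 1) z| + |S₂ (Pi.single x' 1) z|) :=
        Finset.sum_le_sum fun z _ => by
          rw [LinearMap.add_apply, Pi.add_apply]; exact abs_add_le _ _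
    _ ≤ K₁ y'' (blk x') + K₂ y'' (blk x') := by rw [Finset.sum_add_distrib]; exact add_le_add (h₁ x' y'') (h₂ x' y'')

omit [Fintype g.Site] in
/-- Column bounds are invariant under `S ↦ −S`. [cite: Balaban1984PropagatorsII, (2.51) p.232 (bookkeeping ours)] -/
theorem col_neg (blk : X → g.Site) {S : Module.End ℝ (X → ℝ)} {K : g.Site → g.Site → ℝ}
    (h : ∀ (x' : X) (y'' : g.Site), (∑ z ∈ Finset.univ.filter (fun z : X => blk z = y''), |S (Pi.single x' 1) z|) ≤ K y'' (blk x')) :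
    ∀ (x' : X) (y'' : g.Site), (∑ z ∈ Finset.univ.filter (fun z : X => blk z = y''), |(-S) (Pi.single x' 1) z|) ≤ K y'' (blk x') := by
  intro x' y''
  simpa only [LinearMap.neg_apply, Pi.neg_apply, abs_neg] using h x' y''

omit [Fintype g.Site] in
/-- Column bounds of a difference. [cite: Balaban1984PropagatorsII, (2.52)–(2.55) p.232 (bookkeeping ours)] -/
theorem col_sub (blk : X → g.Site) {S₁ S₂ : Module.End ℝ (X → ℝ)} {K₁ K₂ : g.Site → g.Site → ℝ}
    (h₁ : ∀ (x' : X) (y'' : g.Site), (∑ z ∈ Finset.univ.filter (fun z : X => blk z = y''), |S₁ (Pi.single x' 1) z|) ≤ K₁ y'' (blk x'))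
    (h₂ : ∀ (x' : X) (y'' : g.Site), (∑ z ∈ Finset.univ.filter (fun z : X => blk z = y''), |S₂ (Pi.single x' 1) z|) ≤ K₂ y'' (blk x')) :
    ∀ (x' : X) (y'' : g.Site), (∑ z ∈ Finset.univ.filter (fun z : X => blk z = y''), |(S₁ - S₂) (Pi.single x' 1) z|) ≤ K₁ y'' (blk x') + K₂ y'' (blk x') := by
  rw [sub_eq_add_neg]
  exact col_add blk h₁ (col_neg blk h₂)

omit [Fintype g.Site] in
/-- Column bounds of a finite sum with a common shape: `Σ_{k∈s}S_k` has the column bound `(Σ_{k∈s}c_k)·w`.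
[cite: Balaban1984PropagatorsII, (2.52)–(2.55) p.232 (bookkeeping ours)] -/
theorem col_finset_sum {K : Type} (blk : X → g.Site) (s : Finset K) (S : K → Module.End ℝ (X → ℝ)) (cK : K → ℝ)
    (w : g.Site → g.Site → ℝ)
    (h : ∀ k ∈ s, ∀ (x' : X) (y'' : g.Site), (∑ z ∈ Finset.univ.filter (fun z : X => blk z = y''), |S k (Pi.single x' 1) z|) ≤ cK k * w y'' (blk x')) :
    ∀ (x' : X) (y'' : g.Site), (∑ z ∈ Finset.univ.filter (fun z : X => blk z = y''), |(∑ k ∈ s, S k) (Pi.single x' 1) z|) ≤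
      (∑ k ∈ s, cK k) * w y'' (blk x') := by
  classical
  induction s using Finset.induction_on with
  | empty => intro x' y''; simp
  | insert a s ha ih =>
      intro x' y''
      have h' := col_add blk (K₁ := fun a' b' => cK a * w a' b') (K₂ := fun a' b' => (∑ k ∈ s, cK k) * w a' b')
        (h a (Finset.mem_insert_self a s)) (ih fun k hk => h k (Finset.mem_insert_of_mem hk)) x' y''
      rw [Finset.sum_insert ha, Finset.sum_insert ha, add_mul]
      exact h'

end Col

/-! ## §2  Column bounds of the concrete letters of `V′(A)` after real coordinates (the seams of `B9Eq352DivFormLetters` §1, transposed) -/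

section Seam

variable {E : Type*} [NormedAddCommGroup E] [NormedSpace ℝ E] {ι : Type} [Fintype ι] [DecidableEq ι] (b : Module.Basis ι ℝ E)
variable {S : Type} [Fintype S] [DecidableEq S]
variable {g : B9.Geometry} [DecidableEq g.Site]

omit [Fintype S] in
/-- The point mass `δ_{(x′,i)}` of the real-coordinate carrier is the `E`-valued lattice function `x ↦ 𝟙[x = x′]·b_i` (bookkeeping for the columns of
conjugated letters). [cite: Balaban1984PropagatorsII, (2.51) p.232 (bookkeeping ours)] -/
theorem coordSymm_single (x' : S) (i : ι) : (coordEquiv b).symm (Pi.single (x', i) (1 : ℝ)) = Pi.single x' (b i) := by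
  funext x
  rw [coordEquiv_symm_apply]
  by_cases hx : x = x'
  · subst hx
    rw [Pi.single_eq_same]
    have e : ∀ j : ι, (Pi.single (x, i) (1 : ℝ) : S × ι → ℝ) (x, j) • b j = if j = i then b i else 0 := by
      intro j
      by_cases hj : j = i
      · subst hj; rw [Pi.single_eq_same, one_smul, if_pos rfl]
      · rw [Pi.single_eq_of_ne (fun h => hj (Prod.ext_iff.mp h).2), zero_smul, if_neg hj]
    rw [Finset.sum_congr rfl fun j _ => e j, Finset.sum_ite_eq' Finset.univ i, if_pos (Finset.mem_univ _)]
  · rw [Pi.single_eq_of_ne hx]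
    refine Finset.sum_eq_zero fun j _ => ?_
    rw [Pi.single_eq_of_ne (fun h => hx (Prod.ext_iff.mp h).1), zero_smul]

/-- **THE COLUMN SEAM, domination form.**  If the `E`-valued lattice operator `T` is entrywise dominated, `‖(T(δ_{x′}v))(x)‖ ≦ m(x,x′)‖v‖` with `m ≧ 0`, and
the column sums of `m` over each block are bounded, `Σ_{x∈Δ(y″)}m(x,x′) ≦ K(y″,y′)` (`x′ ∈ Δ(y′)`), then after real coordinates the column of `conj b T`
has `ℓ¹`-mass `≦ (#ι·M₂·Σ_i‖b_i‖)·K(y″,y′)` in the block `Δ(y″)` — the transposed twin of `B9Eq352DivFormLetters.hasMajorant_conj_of_local`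
(there: row/sup bounds, [4] (2.51); here: column/`ℓ¹` bounds, needed when the letter stands on the RIGHT of a kernel-bounded operator).
[cite: Balaban1984PropagatorsII, (2.51)–(2.52) p.232; Balaban1985BackgroundPropagators, (3.61) p.402 + (3.37) p.396 (bookkeeping ours)] -/
theorem col_conj_of_dom [Fintype g.Site] (blk : S → g.Site) (M₂ : ℝ) (hM₂ : 0 ≤ M₂) (hrepr : ∀ (v : E) (i : ι), |b.repr v i| ≤ M₂ * ‖v‖)
    (T : Module.End ℝ (S → E)) (m : S → S → ℝ) (hm0 : ∀ x x', 0 ≤ m x x')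
    (hm : ∀ (x x' : S) (v : E), ‖T (Pi.single x' v) x‖ ≤ m x x' * ‖v‖)
    (K : g.Site → g.Site → ℝ)
    (hK : ∀ (x' : S) (y'' : g.Site), (∑ x ∈ Finset.univ.filter (fun x : S => blk x = y''), m x x') ≤ K y'' (blk x')) :
    ∀ (z' : S × ι) (y'' : g.Site), (∑ z ∈ Finset.univ.filter (fun z : S × ι => blk z.1 = y''), |conj b T (Pi.single z' 1) z|) ≤
      (Fintype.card ι * M₂ * ∑ i, ‖b i‖) * K y'' (blk z'.1) := by
  classical
  rintro ⟨x', i⟩ y''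
  have hSb : ‖b i‖ ≤ ∑ j, ‖b j‖ := Finset.single_le_sum (fun j _ => norm_nonneg (b j)) (Finset.mem_univ i)
  have hK0 : 0 ≤ K y'' (blk x') := (Finset.sum_nonneg fun x _ => hm0 x x').trans (hK x' y'')
  -- each entry of the column
  have hentry : ∀ z : S × ι, |conj b T (Pi.single (x', i) 1) z| ≤ M₂ * ‖b i‖ * m z.1 x' := by
    intro z
    rw [conj_apply, coordSymm_single]
    calc |b.repr (T (Pi.single x' (b i)) z.1) z.2| ≤ M₂ * ‖T (Pi.single x' (b i)) z.1‖ := hrepr _ _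
      _ ≤ M₂ * (m z.1 x' * ‖b i‖) := mul_le_mul_of_nonneg_left (hm z.1 x' (b i)) hM₂
      _ = M₂ * ‖b i‖ * m z.1 x' := by ring
  -- the block of the product carrier is `Δ(y″) × ι`
  have hset : Finset.univ.filter (fun z : S × ι => blk z.1 = y'') = (Finset.univ.filter (fun x : S => blk x = y'')) ×ˢ (Finset.univ : Finset ι) := by
    ext z; simp
  calc (∑ z ∈ Finset.univ.filter (fun z : S × ι => blk z.1 = y''), |conj b T (Pi.single (x', i) 1) z|)
      ≤ ∑ z ∈ Finset.univ.filter (fun z : S × ι => blk z.1 = y''), M₂ * ‖b i‖ * m z.1 x' := Finset.sum_le_sum fun z _ => hentry z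
    _ = ∑ x ∈ Finset.univ.filter (fun x : S => blk x = y''), ∑ _j : ι, M₂ * ‖b i‖ * m x x' := by rw [hset, Finset.sum_product]
    _ = (Fintype.card ι * M₂ * ‖b i‖) * ∑ x ∈ Finset.univ.filter (fun x : S => blk x = y''), m x x' := by
        rw [Finset.mul_sum]
        refine Finset.sum_congr rfl fun x _ => ?_
        rw [Finset.sum_const, Finset.card_univ, nsmul_eq_mul]; ring
    _ ≤ (Fintype.card ι * M₂ * ‖b i‖) * K y'' (blk x') := mul_le_mul_of_nonneg_left (hK x' y'') (by positivity)
    _ ≤ (Fintype.card ι * M₂ * ∑ j, ‖b j‖) * K y'' (blk x') := by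
        refine mul_le_mul_of_nonneg_right ?_ hK0
        exact mul_le_mul_of_nonneg_left hSb (by positivity)

/-- **THE COLUMN SEAM, stencil form** — the transposed twin of `hasMajorant_conj_of_local` under the SAME pointwise hypothesis `hT` («‖(Tf)(x)‖ ≦ c(y)·B
whenever ‖f‖ ≦ B on the stencil of x»): if moreover every point `x′` lies in the stencils of at most `n` points `x` (the reverse stencil `rev x′`, in blocks
at `d`-distance `≦ d₀` of the block of `x′`), then the column `x′` of `conj b T` has `ℓ¹`-mass `≦ (#ι·M₂·Σ_i‖b_i‖)·n·c(y″)·e^{δd₀}e^{−δd(y″,y′)}` in `Δ(y″)`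
(`hT` at `B = 0` gives the locality `T(δ_{x′}v)(x) = 0` off the reverse stencil).
[cite: Balaban1984PropagatorsII, (2.51)–(2.52) p.232; Balaban1985BackgroundPropagators, (3.61) p.402 + (3.37) p.396 (bookkeeping ours)] -/
theorem col_conj_of_local [Fintype g.Site] (blk : S → g.Site) (near : S → S → Prop) (rev : S → Finset S) (n : ℕ) (c : g.Site → ℝ) (d₀ δ M₂ : ℝ)
    (hc : ∀ a, 0 ≤ c a) (hδ : 0 ≤ δ) (hM₂ : 0 ≤ M₂) (hrepr : ∀ (v : E) (i : ι), |b.repr v i| ≤ M₂ * ‖v‖)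
    (hrev : ∀ x x', near x x' → x ∈ rev x') (hcard : ∀ x', (rev x').card ≤ n)
    (hrevd : ∀ x x', x ∈ rev x' → g.dist (blk x) (blk x') ≤ d₀)
    (T : Module.End ℝ (S → E))
    (hT : ∀ (f : S → E) (x : S) (B : ℝ), (∀ x'', near x x'' → ‖f x''‖ ≤ B) → ‖T f x‖ ≤ c (blk x) * B) :
    ∀ (z' : S × ι) (y'' : g.Site), (∑ z ∈ Finset.univ.filter (fun z : S × ι => blk z.1 = y''), |conj b T (Pi.single z' 1) z|) ≤
      (Fintype.card ι * M₂ * ∑ i, ‖b i‖) * (n * c y'' * Real.exp (δ * d₀) * Real.exp (-(δ * g.dist y'' (blk z'.1)))) := by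
  classical
  refine col_conj_of_dom b blk M₂ hM₂ hrepr T (fun x x' => if x ∈ rev x' then c (blk x) else 0)
    (fun x x' => by by_cases hx : x ∈ rev x' <;> simp [hx, hc]) ?_ (fun y'' y' => n * c y'' * Real.exp (δ * d₀) * Real.exp (-(δ * g.dist y'' y'))) ?_
  · -- entrywise domination from `hT`
    intro x x' v
    by_cases hx : x ∈ rev x'
    · rw [if_pos hx]
      refine hT _ x ‖v‖ fun x'' _ => ?_
      by_cases h' : x'' = x'
      · subst h'; rw [Pi.single_eq_same]
      · rw [Pi.single_eq_of_ne h', norm_zero]; exact norm_nonneg _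
    · rw [if_neg hx, zero_mul]
      have hnn : ¬ near x x' := fun h => hx (hrev x x' h)
      have h0 : ‖T (Pi.single x' v) x‖ ≤ c (blk x) * 0 := hT _ x 0 fun x'' hx'' => by
        have hne : x'' ≠ x' := fun e => hnn (e ▸ hx'')
        rw [Pi.single_eq_of_ne hne, norm_zero]
      simpa using h0
  · -- column sums of the domination matrix
    intro x' y''
    rw [← Finset.sum_filter]
    set F := (Finset.univ.filter (fun x : S => blk x = y'')).filter (fun x => x ∈ rev x') with hF
    have hFsub : F ⊆ rev x' := fun x hx => (Finset.mem_filter.mp hx).2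
    have hFcard : (F.card : ℝ) ≤ n := by exact_mod_cast (Finset.card_le_card hFsub).trans (hcard x')
    have hsumF : ∑ x ∈ F, c (blk x) = F.card * c y'' := by
      rw [Finset.sum_congr rfl fun x hx => by rw [(Finset.mem_filter.mp (Finset.mem_filter.mp hx).1).2], Finset.sum_const, nsmul_eq_mul]
    rw [hsumF]
    by_cases hne : F.Nonempty
    · obtain ⟨x₀, hx₀⟩ := hne
      have hb0 : blk x₀ = y'' := (Finset.mem_filter.mp (Finset.mem_filter.mp hx₀).1).2
      have hd : g.dist y'' (blk x') ≤ d₀ := hb0 ▸ hrevd x₀ x' (hFsub hx₀)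
      have he : 1 ≤ Real.exp (δ * d₀) * Real.exp (-(δ * g.dist y'' (blk x'))) := by
        rw [← Real.exp_add]; exact Real.one_le_exp (by nlinarith)
      calc (F.card : ℝ) * c y'' ≤ n * c y'' * 1 := by rw [mul_one]; exact mul_le_mul_of_nonneg_right hFcard (hc _)
        _ ≤ n * c y'' * (Real.exp (δ * d₀) * Real.exp (-(δ * g.dist y'' (blk x')))) :=
            mul_le_mul_of_nonneg_left he (mul_nonneg (Nat.cast_nonneg _) (hc _))
        _ = n * c y'' * Real.exp (δ * d₀) * Real.exp (-(δ * g.dist y'' (blk x'))) := by ring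
    · rw [Finset.not_nonempty_iff_eq_empty.mp hne, Finset.card_empty, Nat.cast_zero, zero_mul]
      have := hc y''; positivity

end Seam

section Letters

variable {𝔸 : Type*} [NormedRing 𝔸] [NormedAlgebra ℂ 𝔸] {ι : Type} [Fintype ι] [DecidableEq ι] (b : Module.Basis ι ℝ 𝔸)
variable {S : Type} [Fintype S] [DecidableEq S] {κ : Type}
variable (T : κ → Equiv.Perm S) (U : κ → S → 𝔸ˣ)
variable {g : B9.Geometry} [Fintype g.Site] [DecidableEq g.Site]

omit [Fintype ι] [DecidableEq ι] [Fintype S] [DecidableEq S] in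
/-- `‖i·X‖ = ‖X‖` (plumbing). [folklore] -/
private theorem norm_I_smul₃ (X : 𝔸) : ‖(I : ℂ) • X‖ = ‖X‖ := by
  rw [norm_smul, Complex.norm_I, one_mul]

/-- **Column bound of the coefficient letter `iad_{a}`** (stencil `{x}`, reverse stencil `{x′}`): under `‖a(x)‖ ≦ α₁ℓ(y_x)⁻¹` ((3.37) blockwise),
`Σ_{z∈Δ(y″)}|(conj b (mulLetter a))δ_{z′}(z)| ≦ (#ι·M₂·Σ_i‖b_i‖)·(1·2α₁ℓ(y″)⁻¹·e^{δd₀})·e^{−δd(y″,y′)}`.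
[cite: Balaban1985BackgroundPropagators, (3.37) p.396 + (3.52) p.400 + (3.61) p.402; Balaban1984PropagatorsII, (2.51) p.232 (bookkeeping ours)] -/
theorem col_mulLetter (blk : S → g.Site) (a : S → 𝔸) (d₀ δ M₂ α₁ : ℝ)
    (hα₁ : 0 ≤ α₁) (hδ : 0 ≤ δ) (hM₂ : 0 ≤ M₂) (hrepr : ∀ (v : 𝔸) (i : ι), |b.repr v i| ≤ M₂ * ‖v‖)
    (hlen : ∀ y : g.Site, 0 < g.len y) (ha : ∀ x, ‖a x‖ ≤ α₁ * (g.len (blk x))⁻¹) (hd₀0 : ∀ y : g.Site, g.dist y y ≤ d₀) :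
    ∀ (z' : S × ι) (y'' : g.Site), (∑ z ∈ Finset.univ.filter (fun z : S × ι => blk z.1 = y''), |conj b (mulLetter a) (Pi.single z' 1) z|) ≤
      (Fintype.card ι * M₂ * ∑ i, ‖b i‖) * ((1 : ℕ) * (2 * α₁ * (g.len y'')⁻¹) * Real.exp (δ * d₀) * Real.exp (-(δ * g.dist y'' (blk z'.1)))) := by
  refine col_conj_of_local b blk (fun x x'' => x'' = x) (fun x' => {x'}) 1 (fun y => 2 * α₁ * (g.len y)⁻¹) d₀ δ M₂
    (fun y => by have := hlen y; positivity) hδ hM₂ hrepr (fun x x' h => by rw [h]; exact Finset.mem_singleton_self _)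
    (fun x' => by rw [Finset.card_singleton]) (fun x x' hx => by rw [Finset.mem_singleton.mp hx]; exact hd₀0 _) (mulLetter a) ?_
  intro f x B hB
  have hB' : ‖f x‖ ≤ B := hB x rfl
  rw [mulLetter_apply, norm_I_smul₃]
  calc ‖ad (a x) (f x)‖ ≤ 2 * ‖a x‖ * ‖f x‖ := norm_ad_le _ _
    _ ≤ 2 * (α₁ * (g.len (blk x))⁻¹) * B := by
        have h0 : 0 ≤ α₁ * (g.len (blk x))⁻¹ := mul_nonneg hα₁ (inv_nonneg.mpr (hlen _).le)
        have := ha x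
        gcongr
    _ = 2 * α₁ * (g.len (blk x))⁻¹ * B := by ring

/-- **Column bound of the concrete coefficient letters `V¹_k`** (both orientations: `iad_{A_μ}` and `iad_{τ*_μA_μ}`), (3.37) blockwise.
[cite: Balaban1985BackgroundPropagators, (3.37) p.396 + (3.52) p.400 + (3.61) p.402 + (3.73) p.405; Balaban1984PropagatorsII, (2.51) p.232 (bookkeeping ours)] -/
theorem col_coefLetter (blk : S → g.Site) (A : κ → S → 𝔸) (d₀ δ M₂ α₁ : ℝ)
    (hα₁ : 0 ≤ α₁) (hδ : 0 ≤ δ) (hM₂ : 0 ≤ M₂) (hrepr : ∀ (v : 𝔸) (i : ι), |b.repr v i| ≤ M₂ * ‖v‖)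
    (hlen : ∀ y : g.Site, 0 < g.len y)
    (hA : ∀ μ x, ‖A μ x‖ ≤ α₁ * (g.len (blk x))⁻¹ ∧ ‖tauB T U μ (A μ) x‖ ≤ α₁ * (g.len (blk x))⁻¹)
    (hd₀0 : ∀ y : g.Site, g.dist y y ≤ d₀) (k : κ ⊕ κ) :
    ∀ (z' : S × ι) (y'' : g.Site), (∑ z ∈ Finset.univ.filter (fun z : S × ι => blk z.1 = y''), |conj b (coefLetter T U A k) (Pi.single z' 1) z|) ≤
      ((Fintype.card ι * M₂ * ∑ i, ‖b i‖) * 2 * Real.exp (δ * d₀) * α₁) * (g.len y'')⁻¹ * Real.exp (-(δ * g.dist y'' (blk z'.1))) := by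
  have key : ∀ a : S → 𝔸, (∀ x, ‖a x‖ ≤ α₁ * (g.len (blk x))⁻¹) →
      ∀ (z' : S × ι) (y'' : g.Site), (∑ z ∈ Finset.univ.filter (fun z : S × ι => blk z.1 = y''), |conj b (mulLetter a) (Pi.single z' 1) z|) ≤
        ((Fintype.card ι * M₂ * ∑ i, ‖b i‖) * 2 * Real.exp (δ * d₀) * α₁) * (g.len y'')⁻¹ * Real.exp (-(δ * g.dist y'' (blk z'.1))) := by
    intro a ha z' y''
    refine (col_mulLetter b blk a d₀ δ M₂ α₁ hα₁ hδ hM₂ hrepr hlen ha hd₀0 z' y'').trans (le_of_eq ?_)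
    push_cast; ring
  cases k with
  | inl μ => rw [coefLetter_inl]; exact key (A μ) fun x => (hA μ x).1
  | inr μ => rw [coefLetter_inr]; exact key (tauB T U μ (A μ)) fun x => (hA μ x).2

/-- **Column bound of the forward commutator letter `ad_{∇_μa}∘τ_μ`** (stencil `{x + e_μ}`, reverse stencil `{x′ − e_μ}`): with `‖(c·D¹_μa)(x)‖ ≦ gf(y_x)`,
transports of size `≦ ρ`: `Σ_{z∈Δ(y″)}|(conj b (commLetterF c μ a))δ_{z′}(z)| ≦ (#ι·M₂·Σ‖b‖)·(1·2ρ²gf(y″)·e^{δd₀})·e^{−δd(y″,y′)}`.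
[cite: Balaban1985BackgroundPropagators, (3.37) p.396 + (3.52) p.400; Balaban1985RegularSpaces, (1.87) p.91; Balaban1984PropagatorsII, (2.51) p.232 (bookkeeping ours)] -/
theorem col_commLetterF (blk : S → g.Site) (c : ℂ) (μ : κ) (a : S → 𝔸) (gf : g.Site → ℝ) (ρ d₀ δ M₂ : ℝ)
    (hgf : ∀ y, 0 ≤ gf y) (hδ : 0 ≤ δ) (hM₂ : 0 ≤ M₂) (hrepr : ∀ (v : 𝔸) (i : ι), |b.repr v i| ≤ M₂ * ‖v‖)
    (hg : ∀ x, ‖c • covD T U μ a x‖ ≤ gf (blk x))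
    (hρ : ∀ x, ‖((U μ x : 𝔸ˣ) : 𝔸)‖ ≤ ρ ∧ ‖(((U μ x)⁻¹ : 𝔸ˣ) : 𝔸)‖ ≤ ρ)
    (hd₀ : ∀ x, g.dist (blk x) (blk (T μ x)) ≤ d₀) :
    ∀ (z' : S × ι) (y'' : g.Site), (∑ z ∈ Finset.univ.filter (fun z : S × ι => blk z.1 = y''), |conj b (commLetterF T U c μ a) (Pi.single z' 1) z|) ≤
      (Fintype.card ι * M₂ * ∑ i, ‖b i‖) * ((1 : ℕ) * (2 * ρ ^ 2 * gf y'') * Real.exp (δ * d₀) * Real.exp (-(δ * g.dist y'' (blk z'.1)))) := by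
  refine col_conj_of_local b blk (fun x x'' => x'' = T μ x) (fun x' => {(T μ).symm x'}) 1 (fun y => 2 * ρ ^ 2 * gf y) d₀ δ M₂
    (fun y => by have := hgf y; positivity) hδ hM₂ hrepr
    (fun x x' h => by rw [h, Finset.mem_singleton, Equiv.symm_apply_apply])
    (fun x' => by rw [Finset.card_singleton])
    (fun x x' hx => by
      rw [Finset.mem_singleton.mp hx]
      have := hd₀ ((T μ).symm x')
      rwa [Equiv.apply_symm_apply] at this)
    (commLetterF T U c μ a) ?_
  intro f x B hB
  have hB' : ‖f (T μ x)‖ ≤ B := hB (T μ x) rfl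
  calc ‖commLetterF T U c μ a f x‖ ≤ 2 * ρ ^ 2 * gf (blk x) * ‖f (T μ x)‖ :=
        norm_commLetterF_le T U c μ a f x (hg x) (hρ x).1 (hρ x).2
    _ ≤ 2 * ρ ^ 2 * gf (blk x) * B := by
        have : 0 ≤ 2 * ρ ^ 2 * gf (blk x) := by have := hgf (blk x); positivity
        exact mul_le_mul_of_nonneg_left hB' this

/-- **Column bound of the backward commutator letter `ad_{∇*_μa}∘τ*_μ`** (stencil `{x − e_μ}`, reverse stencil `{x′ + e_μ}`).
[cite: Balaban1985BackgroundPropagators, (3.37) p.396 + (3.52) p.400; Balaban1985RegularSpaces, (1.87) p.91; Balaban1984PropagatorsII, (2.51) p.232 (bookkeeping ours)] -/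
theorem col_commLetterB (blk : S → g.Site) (c : ℂ) (μ : κ) (a : S → 𝔸) (gf : g.Site → ℝ) (ρ d₀ δ M₂ : ℝ)
    (hgf : ∀ y, 0 ≤ gf y) (hδ : 0 ≤ δ) (hM₂ : 0 ≤ M₂) (hrepr : ∀ (v : 𝔸) (i : ι), |b.repr v i| ≤ M₂ * ‖v‖)
    (hg : ∀ x, ‖c • covDstar T U μ a x‖ ≤ gf (blk x))
    (hρ : ∀ x, ‖(((U μ ((T μ).symm x))⁻¹ : 𝔸ˣ) : 𝔸)‖ ≤ ρ ∧ ‖((((U μ ((T μ).symm x))⁻¹)⁻¹ : 𝔸ˣ) : 𝔸)‖ ≤ ρ)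
    (hd₀ : ∀ x, g.dist (blk x) (blk ((T μ).symm x)) ≤ d₀) :
    ∀ (z' : S × ι) (y'' : g.Site), (∑ z ∈ Finset.univ.filter (fun z : S × ι => blk z.1 = y''), |conj b (commLetterB T U c μ a) (Pi.single z' 1) z|) ≤
      (Fintype.card ι * M₂ * ∑ i, ‖b i‖) * ((1 : ℕ) * (2 * ρ ^ 2 * gf y'') * Real.exp (δ * d₀) * Real.exp (-(δ * g.dist y'' (blk z'.1)))) := by
  refine col_conj_of_local b blk (fun x x'' => x'' = (T μ).symm x) (fun x' => {T μ x'}) 1 (fun y => 2 * ρ ^ 2 * gf y) d₀ δ M₂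
    (fun y => by have := hgf y; positivity) hδ hM₂ hrepr
    (fun x x' h => by rw [h, Finset.mem_singleton, Equiv.apply_symm_apply])
    (fun x' => by rw [Finset.card_singleton])
    (fun x x' hx => by
      rw [Finset.mem_singleton.mp hx]
      have := hd₀ (T μ x')
      rwa [Equiv.symm_apply_apply] at this)
    (commLetterB T U c μ a) ?_
  intro f x B hB
  have hB' : ‖f ((T μ).symm x)‖ ≤ B := hB ((T μ).symm x) rfl
  calc ‖commLetterB T U c μ a f x‖ ≤ 2 * ρ ^ 2 * gf (blk x) * ‖f ((T μ).symm x)‖ :=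
        norm_commLetterB_le T U c μ a f x (hg x) (hρ x).1 (hρ x).2
    _ ≤ 2 * ρ ^ 2 * gf (blk x) * B := by
        have : 0 ≤ 2 * ρ ^ 2 * gf (blk x) := by have := hgf (blk x); positivity
        exact mul_le_mul_of_nonneg_left hB' this

/-- **Column bound of the commutators `[V¹_k, ∇_k]`** of the concrete letter families (both orientations), via the operator identities
`V¹∇ − ∇V¹ = −ad_{∇a}∘τ` (`mul_grad_comm_F/B`, the lattice Leibniz rule [B8] (1.87)) and the commutator-letter columns: under (3.37) blockwise
(`‖η⁻¹D¹_μA_μ‖, ‖η⁻¹D¹*_μτ*_μA_μ‖ ≦ α₁ℓ⁻²`), transports `≦ ρ`: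
`Σ_{z∈Δ(y″)}|(conj b V¹_k·conj b ∇_k − conj b ∇_k·conj b V¹_k)δ_{z′}(z)| ≦ (#ι·M₂·Σ‖b‖)·2ρ²e^{δd₀}·α₁ℓ(y″)⁻²·e^{−δd(y″,y′)}`.
[cite: Balaban1985BackgroundPropagators, (3.37) p.396 + (3.52) p.400 + (3.73) p.405; Balaban1985RegularSpaces, (1.87) p.91; Balaban1984PropagatorsII, (2.51) p.232 (bookkeeping ours)] -/
theorem col_comm_coefLetter_diffLetter (blk : S → g.Site) (η : ℝ) (A : κ → S → 𝔸) (ρ d₀ δ M₂ α₁ : ℝ)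
    (hα₁ : 0 ≤ α₁) (hδ : 0 ≤ δ) (hM₂ : 0 ≤ M₂) (hrepr : ∀ (v : 𝔸) (i : ι), |b.repr v i| ≤ M₂ * ‖v‖)
    (h337F : ∀ μ x, ‖((η : ℂ)⁻¹) • covD T U μ (A μ) x‖ ≤ α₁ * (g.len (blk x) ^ 2)⁻¹)
    (h337B : ∀ μ x, ‖((η : ℂ)⁻¹) • covDstar T U μ (tauB T U μ (A μ)) x‖ ≤ α₁ * (g.len (blk x) ^ 2)⁻¹)
    (hρ : ∀ μ x, ‖((U μ x : 𝔸ˣ) : 𝔸)‖ ≤ ρ ∧ ‖(((U μ x)⁻¹ : 𝔸ˣ) : 𝔸)‖ ≤ ρ)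
    (hd₀ : ∀ μ x, g.dist (blk x) (blk (T μ x)) ≤ d₀ ∧ g.dist (blk x) (blk ((T μ).symm x)) ≤ d₀) (k : κ ⊕ κ) :
    ∀ (z' : S × ι) (y'' : g.Site), (∑ z ∈ Finset.univ.filter (fun z : S × ι => blk z.1 = y''),
      |(conj b (coefLetter T U A k) * conj b (diffLetter T U ((η : ℂ)⁻¹) k)
        - conj b (diffLetter T U ((η : ℂ)⁻¹) k) * conj b (coefLetter T U A k)) (Pi.single z' 1) z|) ≤
      ((Fintype.card ι * M₂ * ∑ i, ‖b i‖) * (2 * ρ ^ 2) * Real.exp (δ * d₀) * α₁) * (g.len y'' ^ 2)⁻¹ * Real.exp (-(δ * g.dist y'' (blk z'.1))) := by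
  have hgf : ∀ y : g.Site, 0 ≤ α₁ * (g.len y ^ 2)⁻¹ := fun y => mul_nonneg hα₁ (inv_nonneg.mpr (sq_nonneg _))
  cases k with
  | inl μ =>
      rw [coefLetter_inl, diffLetter_inl]
      have hop : conj b (mulLetter (A μ)) * conj b (gradLetterF T U ((η : ℂ)⁻¹) μ)
          - conj b (gradLetterF T U ((η : ℂ)⁻¹) μ) * conj b (mulLetter (A μ))
          = -conj b (commLetterF T U ((η : ℂ)⁻¹) μ (A μ)) := by
        rw [← B9Eq352DivFormLetters.conj_mul, ← B9Eq352DivFormLetters.conj_mul, ← conj_sub, mul_grad_comm_F, conj_neg]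
      rw [hop]
      intro z' y''
      refine (col_neg (fun p : S × ι => blk p.1)
        (K := fun y'' y' => (Fintype.card ι * M₂ * ∑ i, ‖b i‖) * ((1 : ℕ) * (2 * ρ ^ 2 * (α₁ * (g.len y'' ^ 2)⁻¹)) * Real.exp (δ * d₀) * Real.exp (-(δ * g.dist y'' y'))))
        (col_commLetterF b T U blk ((η : ℂ)⁻¹) μ (A μ) (fun y => α₁ * (g.len y ^ 2)⁻¹) ρ d₀ δ M₂ hgf hδ hM₂
        hrepr (h337F μ) (hρ μ) (fun x => (hd₀ μ x).1)) z' y'').trans (le_of_eq ?_)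
      push_cast; ring
  | inr μ =>
      rw [coefLetter_inr, diffLetter_inr, conj_neg]
      have hop : conj b (mulLetter (tauB T U μ (A μ))) * -conj b (gradLetterB T U ((η : ℂ)⁻¹) μ)
          - -conj b (gradLetterB T U ((η : ℂ)⁻¹) μ) * conj b (mulLetter (tauB T U μ (A μ)))
          = -(conj b (mulLetter (tauB T U μ (A μ))) * conj b (gradLetterB T U ((η : ℂ)⁻¹) μ)
              - conj b (gradLetterB T U ((η : ℂ)⁻¹) μ) * conj b (mulLetter (tauB T U μ (A μ)))) := by
        refine LinearMap.ext fun f => ?_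
        funext p
        simp only [LinearMap.sub_apply, LinearMap.neg_apply, Module.End.mul_apply, map_neg, Pi.sub_apply, Pi.neg_apply]
        ring
      have hop2 : conj b (mulLetter (tauB T U μ (A μ))) * conj b (gradLetterB T U ((η : ℂ)⁻¹) μ)
          - conj b (gradLetterB T U ((η : ℂ)⁻¹) μ) * conj b (mulLetter (tauB T U μ (A μ)))
          = -conj b (commLetterB T U ((η : ℂ)⁻¹) μ (tauB T U μ (A μ))) := by
        rw [← B9Eq352DivFormLetters.conj_mul, ← B9Eq352DivFormLetters.conj_mul, ← conj_sub, mul_grad_comm_B, conj_neg]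
      rw [hop, hop2]
      intro z' y''
      refine (col_neg (fun p : S × ι => blk p.1)
        (K := fun y'' y' => (Fintype.card ι * M₂ * ∑ i, ‖b i‖) * ((1 : ℕ) * (2 * ρ ^ 2 * (α₁ * (g.len y'' ^ 2)⁻¹)) * Real.exp (δ * d₀) * Real.exp (-(δ * g.dist y'' y'))))
        (col_neg (fun p : S × ι => blk p.1)
        (K := fun y'' y' => (Fintype.card ι * M₂ * ∑ i, ‖b i‖) * ((1 : ℕ) * (2 * ρ ^ 2 * (α₁ * (g.len y'' ^ 2)⁻¹)) * Real.exp (δ * d₀) * Real.exp (-(δ * g.dist y'' y'))))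
        (col_commLetterB b T U blk ((η : ℂ)⁻¹) μ (tauB T U μ (A μ)) (fun y => α₁ * (g.len y ^ 2)⁻¹) ρ d₀ δ M₂ hgf hδ hM₂ hrepr (h337B μ)
        (fun x => ⟨(hρ μ ((T μ).symm x)).2, by rw [inv_inv]; exact (hρ μ ((T μ).symm x)).1⟩) (fun x => (hd₀ μ x).2))) z' y'').trans (le_of_eq ?_)
      push_cast; ring

end Letters

section LettersV0

variable {𝔸 : Type*} [NormedRing 𝔸] [NormedAlgebra ℂ 𝔸] [CompleteSpace 𝔸] {ι : Type} [Fintype ι] [DecidableEq ι] (b : Module.Basis ι ℝ 𝔸)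
variable {S : Type} [Fintype S] [DecidableEq S] {κ : Type} [Fintype κ]
variable (T : κ → Equiv.Perm S) (U : κ → S → 𝔸ˣ)
variable {g : B9.Geometry} [Fintype g.Site] [DecidableEq g.Site]

/-- **Column bound of the concrete zeroth-order letter `V⁰`** of (3.52) (stencil `{x} ∪ st(x)`, reverse stencil of at most `1 + 2d` points): in the printed
regime (3.37) blockwise with `ηα₁ℓ⁻¹ ≦ 1/4`, transports `≦ ρ`:
`Σ_{z∈Δ(y″)}|(conj b V⁰)δ_{z′}(z)| ≦ (#ι·M₂·Σ‖b‖)·(1 + 2d)(2 + 8ρ²α₁)d·e^{δd₀}·α₁ℓ(y″)⁻²·e^{−δd(y″,y′)}`.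
[cite: Balaban1985BackgroundPropagators, (3.52) p.400 + (3.54) p.401 + (3.37) p.396 + (3.73) p.405; Balaban1984PropagatorsII, (2.51) p.232 (bookkeeping ours)] -/
theorem col_V0op (blk : S → g.Site) {η : ℝ} (hη : 0 < η) (A : κ → S → 𝔸) (ρ d₀ δ M₂ α₁ : ℝ)
    (hα₁ : 0 ≤ α₁) (hδ : 0 ≤ δ) (hM₂ : 0 ≤ M₂) (hrepr : ∀ (v : 𝔸) (i : ι), |b.repr v i| ≤ M₂ * ‖v‖)
    (hlen : ∀ y : g.Site, 0 < g.len y) (hsmall : ∀ y : g.Site, η * (α₁ * (g.len y)⁻¹) ≤ 1 / 4)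
    (hA : ∀ μ x, ‖A μ x‖ ≤ α₁ * (g.len (blk x))⁻¹ ∧ ‖tauB T U μ (A μ) x‖ ≤ α₁ * (g.len (blk x))⁻¹)
    (h337s : ∀ μ x, ‖((η : ℂ)⁻¹) • covDstar T U μ (A μ) x‖ ≤ α₁ * (g.len (blk x) ^ 2)⁻¹)
    (hρ : ∀ μ x, ‖((U μ x : 𝔸ˣ) : 𝔸)‖ ≤ ρ ∧ ‖(((U μ x)⁻¹ : 𝔸ˣ) : 𝔸)‖ ≤ ρ)
    (hd₀ : ∀ μ x, g.dist (blk x) (blk (T μ x)) ≤ d₀ ∧ g.dist (blk x) (blk ((T μ).symm x)) ≤ d₀)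
    (hd₀0 : ∀ y : g.Site, g.dist y y ≤ d₀) :
    ∀ (z' : S × ι) (y'' : g.Site), (∑ z ∈ Finset.univ.filter (fun z : S × ι => blk z.1 = y''), |conj b (V0op T U η A) (Pi.single z' 1) z|) ≤
      ((Fintype.card ι * M₂ * ∑ i, ‖b i‖) * ((1 + 2 * Fintype.card κ) * ((2 + 8 * ρ ^ 2 * α₁) * Fintype.card κ)) * Real.exp (δ * d₀) * α₁) *
        (g.len y'' ^ 2)⁻¹ * Real.exp (-(δ * g.dist y'' (blk z'.1))) := by
  classical
  have hd : (0 : ℝ) ≤ Fintype.card κ := Nat.cast_nonneg _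
  have hc0 : ∀ y : g.Site, 0 ≤ (2 + 8 * ρ ^ 2 * α₁) * Fintype.card κ * α₁ * (g.len y ^ 2)⁻¹ := fun y => by positivity
  have hcard : ∀ x' : S, (insert x' (Finset.univ.biUnion fun μ : κ => ({(T μ).symm x', T μ x'} : Finset S))).card ≤ 1 + 2 * Fintype.card κ := by
    intro x'
    refine (Finset.card_insert_le _ _).trans ?_
    rw [add_comm]
    refine Nat.add_le_add_left ((Finset.card_biUnion_le).trans ?_) 1
    calc ∑ μ : κ, ({(T μ).symm x', T μ x'} : Finset S).card ≤ ∑ _μ : κ, 2 := Finset.sum_le_sum fun μ _ => Finset.card_le_two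
      _ = 2 * Fintype.card κ := by rw [Finset.sum_const, Finset.card_univ, smul_eq_mul, mul_comm]
  intro z' y''
  refine (col_conj_of_local b blk (fun x x'' => x'' = x ∨ ∃ μ, x'' = T μ x ∨ x'' = (T μ).symm x)
    (fun x' => insert x' (Finset.univ.biUnion fun μ : κ => ({(T μ).symm x', T μ x'} : Finset S))) (1 + 2 * Fintype.card κ)
    (fun y => (2 + 8 * ρ ^ 2 * α₁) * Fintype.card κ * α₁ * (g.len y ^ 2)⁻¹) d₀ δ M₂ hc0 hδ hM₂ hrepr ?_ hcard ?_ (V0op T U η A) ?_ z' y'').trans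
    (le_of_eq ?_)
  · rintro x x' (rfl | ⟨μ, rfl | rfl⟩)
    · exact Finset.mem_insert_self _ _
    · refine Finset.mem_insert_of_mem (Finset.mem_biUnion.mpr ⟨μ, Finset.mem_univ _, ?_⟩)
      simp
    · refine Finset.mem_insert_of_mem (Finset.mem_biUnion.mpr ⟨μ, Finset.mem_univ _, ?_⟩)
      simp
  · intro x x' hx
    rcases Finset.mem_insert.mp hx with rfl | hx
    · exact hd₀0 _
    · obtain ⟨μ, -, hμ⟩ := Finset.mem_biUnion.mp hx
      rcases Finset.mem_insert.mp hμ with rfl | hμ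
      · have := (hd₀ μ ((T μ).symm x')).1
        rwa [Equiv.apply_symm_apply] at this
      · rw [Finset.mem_singleton] at hμ
        subst hμ
        have := (hd₀ μ (T μ x')).2
        rwa [Equiv.symm_apply_apply] at this
  · intro f x B hB
    exact norm_V0op_le_printed T U hη A f x hα₁ (hlen _) (hsmall _) (fun μ => hA μ x) (fun μ => h337s μ x)
      (fun μ => ⟨hρ μ x, hρ μ ((T μ).symm x)⟩) (hB x (Or.inl rfl))
      (fun μ => ⟨hB _ (Or.inr ⟨μ, Or.inl rfl⟩), hB _ (Or.inr ⟨μ, Or.inr rfl⟩)⟩)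
  · push_cast; ring

end LettersV0

section LettersAvg

variable {𝔸 : Type*} [NormedRing 𝔸] [NormedAlgebra ℂ 𝔸] {ι : Type} [Fintype ι] [DecidableEq ι] (b : Module.Basis ι ℝ 𝔸)
variable {S : Type} [Fintype S] [DecidableEq S]
variable {g : B9.Geometry} [Fintype g.Site] [DecidableEq g.Site]

omit [Fintype ι] [DecidableEq ι] in
/-- The column of a block-local kernel operator at a point source: `(K(δ_{x′}v))(y) = 𝟙[x′ ∈ B(y)]·k(y,x′)v`. [cite: Balaban1985BackgroundPropagators, (3.19) p.393 (bookkeeping ours)] -/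
theorem kerOp_single {Y : Type*} [DecidableEq Y] (blk : S → Y) (k : Y → S → 𝔸 →L[ℝ] 𝔸) (x' : S) (v : 𝔸) (y : Y) :
    kerOp blk k (Pi.single x' v) y = if blk x' = y then k y x' v else 0 := by
  rw [kerOp_apply]
  by_cases h : blk x' = y
  · rw [if_pos h, Finset.sum_eq_single x']
    · rw [Pi.single_eq_same]
    · intro x'' _ hne; rw [Pi.single_eq_of_ne hne, map_zero]
    · intro hx'; exact absurd ((mem_block blk y x').mpr h) hx'
  · rw [if_neg h]
    refine Finset.sum_eq_zero fun x'' hx'' => ?_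
    have hne : x'' ≠ x' := fun e => h (e ▸ (mem_block blk y x'').mp hx'')
    rw [Pi.single_eq_of_ne hne, map_zero]

/-- **Column bound of the averaging part `F′₂*aQ′ + Q′*aF′₂ + F′₂*aF′₂` of (3.60)** (block-local with entries of size `w(y)·α₁ℓ⁻²`, `#B(y)·w(y) ≦ 1`): under the
(3.19)/(3.58)/(3.24)-shape data, `Σ_{z∈Δ(y″)}|(conj b avgOp)δ_{z′}(z)| ≦ (#ι·M₂·Σ‖b‖)·a₀C(2 + Cα₁)e^{δd₀}·α₁ℓ(y″)⁻²·e^{−δd(y″,y′)}` — the column twin of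
`B9Eq360VprimeLetters.hasMajorant_avgOp` (entrywise domination, not the sup stencil bound).
[cite: Balaban1985BackgroundPropagators, (3.60)–(3.61) p.402 + (3.58)–(3.59) p.402 + (3.19) p.393 + (3.24) p.394; Balaban1984PropagatorsII, (2.51) p.232 (bookkeeping ours)] -/
theorem col_avgOp (blk : S → g.Site) (kQ kF : g.Site → S → 𝔸 →L[ℝ] 𝔸) (sQ sF : S → 𝔸 →L[ℝ] 𝔸) (c w : g.Site → ℝ) (C α₁ a₀ M₂ d₀ δ : ℝ)
    (hw : ∀ y, 0 ≤ w y) (hcard : ∀ y, ((B9Eq360Vprime.block blk y).card : ℝ) * w y ≤ 1) (hC : 0 ≤ C) (hα₁ : 0 ≤ α₁) (ha₀ : 0 ≤ a₀)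
    (hM₂ : 0 ≤ M₂) (hrepr : ∀ (v : 𝔸) (i : ι), |b.repr v i| ≤ M₂ * ‖v‖) (hδ : 0 ≤ δ) (hd₀0 : ∀ y : g.Site, g.dist y y ≤ d₀)
    (hkQ : ∀ y x, blk x = y → ‖kQ y x‖ ≤ w y) (hkF : ∀ y x, blk x = y → ‖kF y x‖ ≤ C * α₁ * w y)
    (hsQ : ∀ x, ‖sQ x‖ ≤ 1) (hsF : ∀ x, ‖sF x‖ ≤ C * α₁) (hc : ∀ y, |c y| ≤ a₀ * (g.len y ^ 2)⁻¹) :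
    ∀ (z' : S × ι) (y'' : g.Site), (∑ z ∈ Finset.univ.filter (fun z : S × ι => blk z.1 = y''),
      |conj b (B9Eq360VprimeLetters.avgOp blk kQ kF sQ sF c) (Pi.single z' 1) z|) ≤
      ((Fintype.card ι * M₂ * ∑ i, ‖b i‖) * (a₀ * C * (2 + C * α₁)) * Real.exp (δ * d₀) * α₁) * (g.len y'' ^ 2)⁻¹ *
        Real.exp (-(δ * g.dist y'' (blk z'.1))) := by
  classical
  have hκ0 : ∀ y : g.Site, 0 ≤ a₀ * C * (2 + C * α₁) * α₁ * (g.len y ^ 2)⁻¹ * w y := fun y => by have := hw y; positivity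
  intro z' y''
  refine (col_conj_of_dom b blk M₂ hM₂ hrepr (B9Eq360VprimeLetters.avgOp blk kQ kF sQ sF c)
    (fun x x' => if blk x' = blk x then a₀ * C * (2 + C * α₁) * α₁ * (g.len (blk x) ^ 2)⁻¹ * w (blk x) else 0)
    (fun x x' => by by_cases h : blk x' = blk x <;> simp only [h, if_true, if_false, le_refl, hκ0])
    ?_ (fun y'' y' => a₀ * C * (2 + C * α₁) * α₁ * (g.len y'' ^ 2)⁻¹ * Real.exp (δ * d₀) * Real.exp (-(δ * g.dist y'' y'))) ?_ z' y'').trans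
    (le_of_eq (by ring))
  · -- entrywise domination
    intro x x' v
    rw [avgOp_apply, kerOp_single, kerOp_single]
    by_cases h : blk x' = blk x
    · rw [if_pos h, if_pos h, if_pos h]
      have h1 : ‖sF x (c (blk x) • kQ (blk x) x' v)‖ ≤ C * α₁ * (|c (blk x)| * (w (blk x) * ‖v‖)) := by
        refine (ContinuousLinearMap.le_of_opNorm_le _ (hsF x) _).trans (mul_le_mul_of_nonneg_left ?_ (mul_nonneg hC hα₁))
        rw [norm_smul, Real.norm_eq_abs]
        exact mul_le_mul_of_nonneg_left (ContinuousLinearMap.le_of_opNorm_le _ (hkQ _ _ h) _) (abs_nonneg _)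
      have h2 : ‖sQ x (c (blk x) • kF (blk x) x' v)‖ ≤ 1 * (|c (blk x)| * (C * α₁ * w (blk x) * ‖v‖)) := by
        refine (ContinuousLinearMap.le_of_opNorm_le _ (hsQ x) _).trans (mul_le_mul_of_nonneg_left ?_ zero_le_one)
        rw [norm_smul, Real.norm_eq_abs]
        exact mul_le_mul_of_nonneg_left (ContinuousLinearMap.le_of_opNorm_le _ (hkF _ _ h) _) (abs_nonneg _)
      have h3 : ‖sF x (c (blk x) • kF (blk x) x' v)‖ ≤ C * α₁ * (|c (blk x)| * (C * α₁ * w (blk x) * ‖v‖)) := by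
        refine (ContinuousLinearMap.le_of_opNorm_le _ (hsF x) _).trans (mul_le_mul_of_nonneg_left ?_ (mul_nonneg hC hα₁))
        rw [norm_smul, Real.norm_eq_abs]
        exact mul_le_mul_of_nonneg_left (ContinuousLinearMap.le_of_opNorm_le _ (hkF _ _ h) _) (abs_nonneg _)
      have hcx := hc (blk x)
      have hwv : 0 ≤ w (blk x) * ‖v‖ := mul_nonneg (hw _) (norm_nonneg _)
      calc ‖sF x (c (blk x) • kQ (blk x) x' v) + sQ x (c (blk x) • kF (blk x) x' v) + sF x (c (blk x) • kF (blk x) x' v)‖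
          ≤ ‖sF x (c (blk x) • kQ (blk x) x' v)‖ + ‖sQ x (c (blk x) • kF (blk x) x' v)‖ + ‖sF x (c (blk x) • kF (blk x) x' v)‖ :=
            norm_add₃_le
        _ ≤ C * α₁ * (|c (blk x)| * (w (blk x) * ‖v‖)) + 1 * (|c (blk x)| * (C * α₁ * w (blk x) * ‖v‖)) +
              C * α₁ * (|c (blk x)| * (C * α₁ * w (blk x) * ‖v‖)) := add_le_add (add_le_add h1 h2) h3
        _ = C * (2 + C * α₁) * α₁ * |c (blk x)| * (w (blk x) * ‖v‖) := by ring
        _ ≤ C * (2 + C * α₁) * α₁ * (a₀ * (g.len (blk x) ^ 2)⁻¹) * (w (blk x) * ‖v‖) := by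
            have h0 : 0 ≤ C * (2 + C * α₁) * α₁ := by positivity
            exact mul_le_mul_of_nonneg_right (mul_le_mul_of_nonneg_left hcx h0) hwv
        _ = a₀ * C * (2 + C * α₁) * α₁ * (g.len (blk x) ^ 2)⁻¹ * w (blk x) * ‖v‖ := by ring
    · simp [if_neg h]
  · -- column sums: one block, `#B(y)·w(y) ≦ 1`
    intro x' y''
    have hsum : (∑ x ∈ Finset.univ.filter (fun x : S => blk x = y''),
        (if blk x' = blk x then a₀ * C * (2 + C * α₁) * α₁ * (g.len (blk x) ^ 2)⁻¹ * w (blk x) else 0)) =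
        ((B9Eq360Vprime.block blk y'').card : ℝ) * (if blk x' = y'' then a₀ * C * (2 + C * α₁) * α₁ * (g.len y'' ^ 2)⁻¹ * w y'' else 0) := by
      rw [← nsmul_eq_mul, ← Finset.sum_const]
      refine Finset.sum_congr rfl fun x hx => ?_
      rw [(Finset.mem_filter.mp hx).2]
    rw [hsum]
    by_cases h : blk x' = y''
    · rw [if_pos h, h]
      have he : 1 ≤ Real.exp (δ * d₀) * Real.exp (-(δ * g.dist y'' y'')) := by
        rw [← Real.exp_add]; exact Real.one_le_exp (by nlinarith [hd₀0 y''])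
      have hk : 0 ≤ a₀ * C * (2 + C * α₁) * α₁ * (g.len y'' ^ 2)⁻¹ := by positivity
      calc ((B9Eq360Vprime.block blk y'').card : ℝ) * (a₀ * C * (2 + C * α₁) * α₁ * (g.len y'' ^ 2)⁻¹ * w y'')
          = a₀ * C * (2 + C * α₁) * α₁ * (g.len y'' ^ 2)⁻¹ * (((B9Eq360Vprime.block blk y'').card : ℝ) * w y'') := by ring
        _ ≤ a₀ * C * (2 + C * α₁) * α₁ * (g.len y'' ^ 2)⁻¹ * 1 := mul_le_mul_of_nonneg_left (hcard y'') hk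
        _ ≤ a₀ * C * (2 + C * α₁) * α₁ * (g.len y'' ^ 2)⁻¹ * (Real.exp (δ * d₀) * Real.exp (-(δ * g.dist y'' y''))) :=
            mul_le_mul_of_nonneg_left he hk
        _ = a₀ * C * (2 + C * α₁) * α₁ * (g.len y'' ^ 2)⁻¹ * Real.exp (δ * d₀) * Real.exp (-(δ * g.dist y'' y'')) := by ring
    · rw [if_neg h, mul_zero]
      positivity

end LettersAvg

/-! ## §3  The kernel of `T·V′(A)` with the concrete `V′(A)` of (3.60) on the RIGHT of a kernel-bounded operator (divergence form + §1–§2) -/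

section KernelRight

variable {𝔸 : Type*} [NormedRing 𝔸] [NormedAlgebra ℂ 𝔸] [CompleteSpace 𝔸] {ι : Type} [Fintype ι] [DecidableEq ι] (b : Module.Basis ι ℝ 𝔸)
variable {S : Type} [Fintype S] [DecidableEq S] {κ : Type} [Fintype κ]
variable (T : κ → Equiv.Perm S) (U : κ → S → 𝔸ˣ)
variable {g : B9.Geometry} [Fintype g.Site] [DecidableEq g.Site] {Rr : ℝ} {H : Prop}

set_option maxHeartbeats 1600000 in
/-- **THE KERNEL OF `T·V′(A)` — THE CONCRETE `V′(A)` OF (3.60) ON THE RIGHT OF A KERNEL-BOUNDED OPERATOR.**  Print (p. 403 l. 7–9): «the remainders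
G′(U)V′(A)G′(U′U) and G′(U′U)V′(A)G′(U) in (3.65) … satisfy Theorem 3.1 with the additional small factor O(1)α₁»; the second remainder has `V′(A)` to the
RIGHT of `G′(U′U)`.  From kernel bounds in the printed shape of (3.42) for the right entries `T` (weight `w_T`) and `T∇*_k` (weight `w_T(Lʲη)⁻¹`) for every
concrete difference letter (print: `T = G′(U′U)`, `w_T = (Lʲη)²`, Theorem 3.1 for the extended operator, (3.42)₁,₃), the DIVERGENCE FORM of the concrete
`V′(A)` after coordinates, `V′ = Σ_k∇_kV¹_k + C″`, `C″ = (V⁰ − avgOp) + Σ_k[V¹_k, ∇_k]` (`conj_vPrimeConc_eq_gradForm` + `divForm_of_gradForm_sum`), the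
COLUMN bounds of §2 for `V¹_k` (`α₁(Lʲη)⁻¹`), `V⁰`, the averaging part and the commutators (`α₁(Lʲη)⁻²`) — (3.61)/(3.37) read entrywise —, the scale
transfers of `(Lʲη)⁻¹`, `(Lʲη)⁻²` at exponent `α`, of the block-volume weight `v⁻¹` at rate `γ` (`Λ_v`), and [4] (2.61) at `β` (`ρ + (α+β)δ₀ ≦ δ`):
`|(T·V′(A))(x,x′)| ≦ Θ·α₁·w_T(y)(Lʲη)⁻²·e^{−ρd(y,y′)}·v(y′)⁻¹` with the explicit `Θ` of the statement («O(1)B₀α₁» with `B₀` = the constant of `T`).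
[cite: Balaban1985BackgroundPropagators, (3.65) p.402 + p.403 l.7–9 + (3.60)–(3.61) p.402 + (3.52) p.400 + (3.37) p.396 + (3.42) p.397 + p.398 remark; Balaban1985RegularSpaces, (1.87) p.91; Balaban1984PropagatorsII, (2.51)–(2.55) p.232 + Lemma 2.1 (2.61) p.234 + (2.64)–(2.66) p.234] -/
theorem hasKernelBound_mul_vPrime_right (blk : S → g.Site) (d : ℕ) {η : ℝ} (hη : 0 < η)
    (A : κ → S → 𝔸) (kQ kF : g.Site → S → 𝔸 →L[ℝ] 𝔸) (sQ sF : S → 𝔸 →L[ℝ] 𝔸) (c w : g.Site → ℝ) (ρu d₀ M₂ C a₀ : ℝ)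
    (δ₀ δ α β γ ρ Λ Λv B₀ α₁ : ℝ) (wT : g.Site → ℝ) {v : g.Site → ℝ} (hv : ∀ y, 0 < v y) {cK : ℝ} (hcK : 0 < cK)
    (hB₀ : 0 ≤ B₀) (hα₁ : 0 ≤ α₁) (hΛ : 0 ≤ Λ) (hΛv : 0 ≤ Λv) (hρ : 0 ≤ ρ) (hγ : 0 ≤ γ)
    (hr : ρ + (α + β) * δ₀ ≤ δ)
    (hdnn : ∀ a a' : g.Site, 0 ≤ g.dist a a') (htri : Triangle254 (toB6 g Rr H)) (hlen : ∀ y : g.Site, 0 < g.len y)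
    (h261 : Ineq261 d (toB6 g Rr H) δ₀ β) (hwT : ∀ a, 0 ≤ wT a)
    (hT1i : ScaleTransfer g δ₀ α Λ (fun a => (g.len a)⁻¹)) (hT2i : ScaleTransfer g δ₀ α Λ (fun a => (g.len a ^ 2)⁻¹))
    (hTv : ∀ a a' : g.Site, Real.exp (-(γ * g.dist a a')) * (v a)⁻¹ ≤ Λv * (v a')⁻¹)
    (hM₂ : 0 ≤ M₂) (hrepr : ∀ (v : 𝔸) (i : ι), |b.repr v i| ≤ M₂ * ‖v‖)
    (hsmall : ∀ y : g.Site, η * (α₁ * (g.len y)⁻¹) ≤ 1 / 4)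
    (hA : ∀ μ x, ‖A μ x‖ ≤ α₁ * (g.len (blk x))⁻¹ ∧ ‖tauB T U μ (A μ) x‖ ≤ α₁ * (g.len (blk x))⁻¹)
    (h337s : ∀ μ x, ‖((η : ℂ)⁻¹) • covDstar T U μ (A μ) x‖ ≤ α₁ * (g.len (blk x) ^ 2)⁻¹)
    (h337F : ∀ μ x, ‖((η : ℂ)⁻¹) • covD T U μ (A μ) x‖ ≤ α₁ * (g.len (blk x) ^ 2)⁻¹)
    (h337B : ∀ μ x, ‖((η : ℂ)⁻¹) • covDstar T U μ (tauB T U μ (A μ)) x‖ ≤ α₁ * (g.len (blk x) ^ 2)⁻¹)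
    (hρu : ∀ μ x, ‖((U μ x : 𝔸ˣ) : 𝔸)‖ ≤ ρu ∧ ‖(((U μ x)⁻¹ : 𝔸ˣ) : 𝔸)‖ ≤ ρu)
    (hd₀ : ∀ μ x, g.dist (blk x) (blk (T μ x)) ≤ d₀ ∧ g.dist (blk x) (blk ((T μ).symm x)) ≤ d₀)
    (hd₀0 : ∀ y : g.Site, g.dist y y ≤ d₀)
    (hw : ∀ y, 0 ≤ w y) (hcard : ∀ y, ((B9Eq360Vprime.block blk y).card : ℝ) * w y ≤ 1) (hC : 0 ≤ C) (ha₀ : 0 ≤ a₀)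
    (hkQ : ∀ y x, blk x = y → ‖kQ y x‖ ≤ w y) (hkF : ∀ y x, blk x = y → ‖kF y x‖ ≤ C * α₁ * w y)
    (hsQ : ∀ x, ‖sQ x‖ ≤ 1) (hsF : ∀ x, ‖sF x‖ ≤ C * α₁) (hc : ∀ y, |c y| ≤ a₀ * (g.len y ^ 2)⁻¹)
    {Tr : Module.End ℝ (S × ι → ℝ)}
    (hT : HasKernelBound (g := toB6 g Rr H) (fun p : S × ι => blk p.1) v cK Tr (fun a a' => B₀ * wT a * Real.exp (-(δ * g.dist a a'))))
    (hTD : ∀ k : κ ⊕ κ, HasKernelBound (g := toB6 g Rr H) (fun p : S × ι => blk p.1) v cK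
      (Tr * conj b (diffLetter T U ((η : ℂ)⁻¹) k)) (fun a a' => B₀ * (wT a * (g.len a)⁻¹) * Real.exp (-(δ * g.dist a a')))) :
    HasKernelBound (g := toB6 g Rr H) (fun p : S × ι => blk p.1) v cK (Tr * conj b (vPrimeConc T U η A blk kQ kF sQ sF c))
      (fun a a' => (Λv * Λ * B6.c1 d δ₀ β * B₀ * ((Fintype.card ι * M₂ * ∑ i, ‖b i‖) * Real.exp ((ρ + γ) * d₀) * α₁ *
          (4 * Fintype.card κ + ((1 + 2 * Fintype.card κ) * ((2 + 8 * ρu ^ 2 * α₁) * Fintype.card κ) + a₀ * C * (2 + C * α₁)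
            + 4 * Fintype.card κ * ρu ^ 2)))) * (wT a * (g.len a ^ 2)⁻¹) * Real.exp (-(ρ * g.dist a a'))) := by
  classical
  -- abbreviations
  set cι : ℝ := Fintype.card ι * M₂ * ∑ i, ‖b i‖ with hcι
  set E₀ : ℝ := Real.exp ((ρ + γ) * d₀) with hE₀
  set D : κ ⊕ κ → Module.End ℝ (S × ι → ℝ) := fun k => conj b (diffLetter T U ((η : ℂ)⁻¹) k) with hD
  set Ck : κ ⊕ κ → Module.End ℝ (S × ι → ℝ) := fun k => conj b (coefLetter T U A k) with hCk
  set Z : Module.End ℝ (S × ι → ℝ) := conj b (V0op T U η A) - conj b (B9Eq360VprimeLetters.avgOp blk kQ kF sQ sF c) with hZ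
  set Cpp : Module.End ℝ (S × ι → ℝ) := Z + ∑ k ∈ Finset.univ, (Ck k * D k - D k * Ck k) with hCpp
  have hSb : 0 ≤ ∑ i, ‖b i‖ := Finset.sum_nonneg fun i _ => norm_nonneg _
  have hcι0 : 0 ≤ cι := by rw [hcι]; positivity
  have hE₀0 : 0 ≤ E₀ := Real.exp_nonneg _
  have hργ : 0 ≤ ρ + γ := add_nonneg hρ hγ
  have hd : (0 : ℝ) ≤ Fintype.card κ := Nat.cast_nonneg _
  -- the divergence form of the concrete `V′(A)` after coordinates
  have hgrad : conj b (vPrimeConc T U η A blk kQ kF sQ sF c) = Z + ∑ k ∈ Finset.univ, Ck k * D k :=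
    conj_vPrimeConc_eq_gradForm b T U η A blk kQ kF sQ sF c
  have hdiv : conj b (vPrimeConc T U η A blk kQ kF sQ sF c) = ∑ k ∈ Finset.univ, D k * Ck k + Cpp :=
    B9Ineq386CommSum.divForm_of_gradForm_sum Finset.univ hgrad
  have hop : Tr * conj b (vPrimeConc T U η A blk kQ kF sQ sF c) = ∑ k ∈ Finset.univ, Tr * D k * Ck k + Tr * Cpp := by
    rw [hdiv, mul_add, Finset.mul_sum]
    simp only [mul_assoc]
  -- column bounds of the right letters, at the rate `ρ + γ`
  have colC : ∀ k : κ ⊕ κ, ∀ (z' : S × ι) (y'' : g.Site),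
      (∑ z ∈ Finset.univ.filter (fun z : S × ι => blk z.1 = y''), |Ck k (Pi.single z' 1) z|) ≤
        (cι * 2 * E₀ * α₁) * (g.len y'')⁻¹ * Real.exp (-((ρ + γ) * g.dist y'' (blk z'.1))) := fun k =>
    col_coefLetter b T U blk A d₀ (ρ + γ) M₂ α₁ hα₁ hργ hM₂ hrepr hlen hA hd₀0 k
  have colZ : ∀ (z' : S × ι) (y'' : g.Site), (∑ z ∈ Finset.univ.filter (fun z : S × ι => blk z.1 = y''), |Z (Pi.single z' 1) z|) ≤
      (cι * ((1 + 2 * Fintype.card κ) * ((2 + 8 * ρu ^ 2 * α₁) * Fintype.card κ)) * E₀ * α₁) * (g.len y'' ^ 2)⁻¹ *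
          Real.exp (-((ρ + γ) * g.dist y'' (blk z'.1)))
        + (cι * (a₀ * C * (2 + C * α₁)) * E₀ * α₁) * (g.len y'' ^ 2)⁻¹ * Real.exp (-((ρ + γ) * g.dist y'' (blk z'.1))) :=
    col_sub (fun p : S × ι => blk p.1)
      (K₁ := fun y'' y' => (cι * ((1 + 2 * Fintype.card κ) * ((2 + 8 * ρu ^ 2 * α₁) * Fintype.card κ)) * E₀ * α₁) * (g.len y'' ^ 2)⁻¹ *
        Real.exp (-((ρ + γ) * g.dist y'' y')))
      (K₂ := fun y'' y' => (cι * (a₀ * C * (2 + C * α₁)) * E₀ * α₁) * (g.len y'' ^ 2)⁻¹ * Real.exp (-((ρ + γ) * g.dist y'' y')))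
      (col_V0op b T U blk hη A ρu d₀ (ρ + γ) M₂ α₁ hα₁ hργ hM₂ hrepr hlen hsmall hA h337s hρu hd₀ hd₀0)
      (col_avgOp b blk kQ kF sQ sF c w C α₁ a₀ M₂ d₀ (ρ + γ) hw hcard hC hα₁ ha₀ hM₂ hrepr hργ hd₀0 hkQ hkF hsQ hsF hc)
  have colComm : ∀ k ∈ (Finset.univ : Finset (κ ⊕ κ)), ∀ (z' : S × ι) (y'' : g.Site),
      (∑ z ∈ Finset.univ.filter (fun z : S × ι => blk z.1 = y''), |(Ck k * D k - D k * Ck k) (Pi.single z' 1) z|) ≤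
        (cι * (2 * ρu ^ 2) * E₀ * α₁) * ((g.len y'' ^ 2)⁻¹ * Real.exp (-((ρ + γ) * g.dist y'' (blk z'.1)))) := fun k _ z' y'' =>
    (col_comm_coefLetter_diffLetter b T U blk η A ρu d₀ (ρ + γ) M₂ α₁ hα₁ hργ hM₂ hrepr h337F h337B hρu hd₀ k z' y'').trans (le_of_eq (by ring))
  have colSum := col_finset_sum (fun p : S × ι => blk p.1) Finset.univ (fun k => Ck k * D k - D k * Ck k) (fun _ => cι * (2 * ρu ^ 2) * E₀ * α₁)
    (fun y'' y' => (g.len y'' ^ 2)⁻¹ * Real.exp (-((ρ + γ) * g.dist y'' y'))) colComm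
  have colCpp : ∀ (z' : S × ι) (y'' : g.Site), (∑ z ∈ Finset.univ.filter (fun z : S × ι => blk z.1 = y''), |Cpp (Pi.single z' 1) z|) ≤
      (cι * E₀ * α₁ * ((1 + 2 * Fintype.card κ) * ((2 + 8 * ρu ^ 2 * α₁) * Fintype.card κ) + a₀ * C * (2 + C * α₁)
        + 4 * Fintype.card κ * ρu ^ 2)) * (g.len y'' ^ 2)⁻¹ * Real.exp (-((ρ + γ) * g.dist y'' (blk z'.1))) := by
    intro z' y''
    refine (col_add (fun p : S × ι => blk p.1)
      (K₁ := fun y'' y' => (cι * ((1 + 2 * Fintype.card κ) * ((2 + 8 * ρu ^ 2 * α₁) * Fintype.card κ)) * E₀ * α₁) * (g.len y'' ^ 2)⁻¹ *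
          Real.exp (-((ρ + γ) * g.dist y'' y'))
        + (cι * (a₀ * C * (2 + C * α₁)) * E₀ * α₁) * (g.len y'' ^ 2)⁻¹ * Real.exp (-((ρ + γ) * g.dist y'' y'))) colZ
      (K₂ := fun y'' y' => (∑ _k : κ ⊕ κ, cι * (2 * ρu ^ 2) * E₀ * α₁) * ((g.len y'' ^ 2)⁻¹ * Real.exp (-((ρ + γ) * g.dist y'' y'))))
      colSum z' y'').trans (le_of_eq ?_)
    rw [Finset.sum_const, Finset.card_univ, Fintype.card_sum, nsmul_eq_mul, Nat.cast_add]
    ring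
  -- kernel × column, term by term
  have hw₁ : ∀ a : g.Site, 0 ≤ wT a * (g.len a)⁻¹ := fun a => mul_nonneg (hwT a) (inv_nonneg.mpr (hlen a).le)
  have termC : ∀ k ∈ (Finset.univ : Finset (κ ⊕ κ)), HasKernelBound (g := toB6 g Rr H) (fun p : S × ι => blk p.1) v cK (Tr * D k * Ck k)
      (fun a a' => (Λv * Λ * B6.c1 d δ₀ β * B₀ * (cι * 2 * E₀ * α₁)) * ((wT a * (g.len a)⁻¹) * (g.len a)⁻¹) * Real.exp (-(ρ * g.dist a a'))) :=
    fun k _ => hasKernelBound_mul_col (R := Rr) (H := H) (fun p : S × ι => blk p.1) hv hcK d (fun a => wT a * (g.len a)⁻¹) (fun a => (g.len a)⁻¹)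
      hw₁ (fun a => inv_nonneg.mpr (hlen a).le) hB₀ (by positivity) hΛ hΛv hρ hr hdnn htri hT1i h261 hTv (hTD k) (colC k)
  have termCpp : HasKernelBound (g := toB6 g Rr H) (fun p : S × ι => blk p.1) v cK (Tr * Cpp)
      (fun a a' => (Λv * Λ * B6.c1 d δ₀ β * B₀ * (cι * E₀ * α₁ * ((1 + 2 * Fintype.card κ) * ((2 + 8 * ρu ^ 2 * α₁) * Fintype.card κ)
        + a₀ * C * (2 + C * α₁) + 4 * Fintype.card κ * ρu ^ 2))) * (wT a * (g.len a ^ 2)⁻¹) * Real.exp (-(ρ * g.dist a a'))) :=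
    hasKernelBound_mul_col (R := Rr) (H := H) (fun p : S × ι => blk p.1) hv hcK d wT (fun a => (g.len a ^ 2)⁻¹) hwT
      (fun a => inv_nonneg.mpr (sq_nonneg _)) hB₀ (by positivity) hΛ hΛv hρ hr hdnn htri hT2i h261 hTv hT colCpp
  have hsum := hasKernelBound_finset_sum (R := Rr) (H := H) (fun p : S × ι => blk p.1) Finset.univ (fun k => Tr * D k * Ck k) _ termC
  have hall := hasKernelBound_add (g := toB6 g Rr H) (fun p : S × ι => blk p.1) hsum termCpp
  rw [hop]
  refine hasKernelBound_mono (g := toB6 g Rr H) _ hv hall fun a a' => le_of_eq ?_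
  have hl : (g.len a)⁻¹ * (g.len a)⁻¹ = (g.len a ^ 2)⁻¹ := by rw [pow_two, mul_inv]
  simp only [Finset.sum_const, Finset.card_univ, Fintype.card_sum, nsmul_eq_mul, Nat.cast_add]
  rw [mul_assoc (wT a) ((g.len a)⁻¹) ((g.len a)⁻¹), hl]
  ring

end KernelRight

/-! ## §4  The abstract transfer: an `L²` block bound for `T₀ = G(U)D₂` and a KERNEL bound for `W = G(U′U)·V` give the `L²` block bound for
`G(U′U)D₂ = T₀ + W·T₀` -/

section L2

variable {X : Type} [Fintype X]

/-- `(Σ_x f(x)²)^{1/2}` is the Euclidean norm of `f` (plumbing). [folklore] -/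
private theorem sqrt_sum_sq_eq_norm (f : X → ℝ) : Real.sqrt (∑ x, f x ^ 2) = ‖(WithLp.toLp 2 f : EuclideanSpace ℝ X)‖ := by
  rw [EuclideanSpace.norm_eq]
  congr 1
  refine Finset.sum_congr rfl fun x _ => ?_
  rw [PiLp.toLp_apply, Real.norm_eq_abs, sq_abs]

/-- Minkowski for two summands (plumbing). [folklore] -/
private theorem sqrt_sum_sq_add_le (f₁ f₂ : X → ℝ) :
    Real.sqrt (∑ x, (f₁ x + f₂ x) ^ 2) ≤ Real.sqrt (∑ x, f₁ x ^ 2) + Real.sqrt (∑ x, f₂ x ^ 2) := by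
  have e : (∑ x, (f₁ x + f₂ x) ^ 2) = ∑ x, ((f₁ + f₂) x) ^ 2 := rfl
  rw [e, sqrt_sum_sq_eq_norm, sqrt_sum_sq_eq_norm, sqrt_sum_sq_eq_norm, WithLp.toLp_add]
  exact norm_add_le _ _

/-- Minkowski for a finite sum (plumbing). [folklore] -/
private theorem sqrt_sum_sq_sum_le {I : Type*} (s : Finset I) (F : I → X → ℝ) :
    Real.sqrt (∑ x, (∑ i ∈ s, F i x) ^ 2) ≤ ∑ i ∈ s, Real.sqrt (∑ x, F i x ^ 2) := by
  classical
  refine Finset.induction_on s ?_ ?_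
  · simp
  · intro a s ha ih
    simp only [Finset.sum_insert ha]
    exact (sqrt_sum_sq_add_le _ _).trans (by linarith)

end L2

section Device

variable {g : B9.Geometry} [Fintype g.Site] [DecidableEq g.Site] {R : ℝ} {H : Prop} {X : Type} [Fintype X] [DecidableEq X]

set_option maxHeartbeats 800000 in
/-- **`L²` MEMBER WITH TWO RIGHT DIFFERENCES SURVIVES THE PERTURBATION — abstract device.**  On a block carrier: `T₀` (in use: `G′(U)∇*∇*`) with the
`L²` block bound `‖h·T₀ν‖₂ ≦ A₀|h|e^{−rd(y,y″)}‖ν‖₂` ((3.46)₆ FOR `U`), `W` (in use: `G′(U′U)V′(A)`) with the KERNEL bound `|W(x,x′)| ≦ A_We^{−ρd}v(y′)⁻¹`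
(§3), and `E = T₀ + W·T₀` (in use: `G′(U′U)∇*∇*`, from `G′(U′U) = G′(U) + G′(U′U)V′(A)G′(U)`, (3.65)₂).  THEN
`‖h·Eλ‖₂ ≦ A₀(1 + c_vΛA_Wc₁(δ₀,β))|h|e^{−ρ″d(y,y′)}‖λ‖₂` for `ρ′ + αδ₀ ≦ ρ`, `ρ″ + βδ₀ ≦ ρ′`, `ρ″ ≦ r`: insert `Σ_{y″}Δ(y″) = I` between `W` and
`T₀` ([4] (2.52)), Minkowski, Schur for `h·W` on the piece (FILE 39 `l2_block_of_kernelBound_transfer`), the input bound for the piece `Δ(y″)T₀λ` (with the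
indicator of `Δ(y″)` as multiplier), and [4] (2.61) for the `y″`-sum (`conv_le`) — the mirror image of FILE 40's `l2_left_transfer`.
[cite: Balaban1985BackgroundPropagators, Thm 3.4 p.400 + (3.46) p.398 + (3.65) p.402 + p.403 l.2–9; Balaban1984PropagatorsII, (2.52) p.232 + Lemma 2.1 (2.61) p.234 (bookkeeping ours)] -/
theorem l2_right_transfer (blk : X → g.Site) {v : g.Site → ℝ} (hv : ∀ y, 0 < v y) {c cv : ℝ} (hc : 0 < c)
    (hvol : ∀ y : g.Site, c * ((Finset.univ.filter (fun x : X => blk x = y)).card : ℝ) ≤ cv * v y) (d : ℕ)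
    {δ₀ α β Λ ρ ρ' ρ'' r A₀ AW : ℝ} (hA₀ : 0 ≤ A₀) (hAW : 0 ≤ AW) (hρ'' : 0 ≤ ρ'')
    (hρ'ρ : ρ' + α * δ₀ ≤ ρ) (hρ''ρ' : ρ'' + β * δ₀ ≤ ρ') (hρ''r : ρ'' ≤ r)
    (hdnn : ∀ a a' : g.Site, 0 ≤ g.dist a a') (htri : Triangle254 (toB6 g R H)) (h261 : Ineq261 d (toB6 g R H) δ₀ β)
    (hT : ScaleTransfer g δ₀ α Λ (fun a => (Real.sqrt (v a))⁻¹))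
    {T₀ W E : Module.End ℝ (X → ℝ)} (hE : E = T₀ + W * T₀)
    (hT₀ : ∀ (y y'' : g.Site) (hf ν : X → ℝ) (Hh : ℝ), 0 ≤ Hh → (∀ x, |hf x| ≤ Hh) → (∀ x, blk x ≠ y → hf x = 0) →
      (∀ x, blk x ≠ y'' → ν x = 0) →
      Real.sqrt (∑ x, (hf x * T₀ ν x) ^ 2) ≤ A₀ * Hh * Real.exp (-(r * g.dist y y'')) * Real.sqrt (∑ x, ν x ^ 2))
    (hW : HasKernelBound (g := toB6 g R H) blk v c W (fun a a' => AW * Real.exp (-(ρ * g.dist a a'))))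
    (y y' : g.Site) (hf μ : X → ℝ) (Hh : ℝ) (hHh : 0 ≤ Hh) (hh : ∀ x, |hf x| ≤ Hh) (hh0 : ∀ x, blk x ≠ y → hf x = 0)
    (hμ0 : ∀ x, blk x ≠ y' → μ x = 0) :
    Real.sqrt (∑ x, (hf x * E μ x) ^ 2) ≤
      (A₀ * (1 + cv * Λ * AW * B6.c1 d δ₀ β)) * Hh * Real.exp (-(ρ'' * g.dist y y')) * Real.sqrt (∑ x, μ x ^ 2) := by
  classical
  obtain ⟨y₀⟩ : Nonempty g.Site := ⟨y⟩
  have hN : 0 ≤ Real.sqrt (∑ x, μ x ^ 2) := Real.sqrt_nonneg _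
  have hc₁ : 0 ≤ B6.c1 d δ₀ β := B6RandomWalk.c1_nonneg d δ₀ β
  have hcv : 0 ≤ cv := by
    have h4 : 0 ≤ c * ((Finset.univ.filter (fun x : X => blk x = y₀)).card : ℝ) := by positivity
    have h0 : 0 * v y₀ ≤ cv * v y₀ := by rw [zero_mul]; exact h4.trans (hvol y₀)
    exact le_of_mul_le_mul_right h0 (hv y₀)
  have hΛ : 0 ≤ Λ := by
    have hs : 0 < (Real.sqrt (v y₀))⁻¹ := inv_pos.mpr (Real.sqrt_pos.mpr (hv y₀))
    have h0 : 0 * (Real.sqrt (v y₀))⁻¹ ≤ Λ * (Real.sqrt (v y₀))⁻¹ := by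
      rw [zero_mul]
      exact (mul_nonneg (Real.exp_nonneg _) hs.le).trans (hT y₀ y₀)
    exact le_of_mul_le_mul_right h0 hs
  -- `Eλ = T₀λ + Σ_{y″} W(Δ(y″)·T₀λ)` ([4] (2.52))
  have hsplit : ∀ x, hf x * E μ x =
      hf x * T₀ μ x + ∑ y'' : g.Site, hf x * W (blockPiece (g := toB6 g R H) blk y'' (T₀ μ)) x := by
    intro x
    have e2 : W (T₀ μ) = ∑ y'' : g.Site, W (blockPiece (g := toB6 g R H) blk y'' (T₀ μ)) := by
      rw [← map_sum]
      exact congrArg W (sum_blockPiece (g := toB6 g R H) blk (T₀ μ)).symm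
    rw [hE, LinearMap.add_apply, Module.End.mul_apply, Pi.add_apply, e2, Finset.sum_apply, mul_add, Finset.mul_sum]
  -- Minkowski
  have hmain : Real.sqrt (∑ x, (hf x * E μ x) ^ 2) ≤ Real.sqrt (∑ x, (hf x * T₀ μ x) ^ 2) +
      ∑ y'' : g.Site, Real.sqrt (∑ x, (hf x * W (blockPiece (g := toB6 g R H) blk y'' (T₀ μ)) x) ^ 2) := by
    have e : (∑ x, (hf x * E μ x) ^ 2) =
        ∑ x, (hf x * T₀ μ x + ∑ y'' : g.Site, hf x * W (blockPiece (g := toB6 g R H) blk y'' (T₀ μ)) x) ^ 2 :=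
      Finset.sum_congr rfl fun x _ => by rw [hsplit x]
    rw [e]
    exact (sqrt_sum_sq_add_le _ _).trans (add_le_add le_rfl (sqrt_sum_sq_sum_le _ _))
  -- the unperturbed term
  have h1 : Real.sqrt (∑ x, (hf x * T₀ μ x) ^ 2) ≤ A₀ * Hh * Real.exp (-(ρ'' * g.dist y y')) * Real.sqrt (∑ x, μ x ^ 2) :=
    (hT₀ y y' hf μ Hh hHh hh hh0 hμ0).trans
      (mul_le_mul_of_nonneg_right (mul_le_mul_of_nonneg_left (exp_rate_mono hρ''r (hdnn _ _)) (mul_nonneg hA₀ hHh)) hN)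
  -- each piece: Schur for `h·W` on `Δ(y″)T₀λ`, then the input bound for the piece (indicator of `Δ(y″)` as multiplier)
  have hW' := hasKernelBound_mono (g := toB6 g R H) blk hv hW (K' := fun a a' => AW * (1 : ℝ) * Real.exp (-(ρ * g.dist a a')))
    fun a a' => le_of_eq (by ring)
  have hpiece : ∀ y'' : g.Site, Real.sqrt (∑ x, (hf x * W (blockPiece (g := toB6 g R H) blk y'' (T₀ μ)) x) ^ 2) ≤
      cv * Λ * AW * Hh * 1 * Real.exp (-(ρ' * g.dist y y'')) *
        (A₀ * 1 * Real.exp (-(r * g.dist y'' y')) * Real.sqrt (∑ x, μ x ^ 2)) := by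
    intro y''
    have hν0 : ∀ x, blk x ≠ y'' → blockPiece (g := toB6 g R H) blk y'' (T₀ μ) x = 0 := fun x hx => by
      simp [blockPiece, hx]
    refine (l2_block_of_kernelBound_transfer (R := R) (H := H) blk hv hc hvol hAW hρ'ρ hdnn hT (w := fun _ => (1 : ℝ))
      (fun _ => zero_le_one) hW' y y'' hf _ Hh hHh hh hh0 hν0).trans (mul_le_mul_of_nonneg_left ?_ ?_)
    · have hind : ∀ x, blockPiece (g := toB6 g R H) blk y'' (T₀ μ) x = (if blk x = y'' then (1 : ℝ) else 0) * T₀ μ x := fun x => by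
        by_cases hx : blk x = y'' <;> simp [blockPiece, hx]
      have e : (∑ x, (blockPiece (g := toB6 g R H) blk y'' (T₀ μ) x) ^ 2) = ∑ x, ((if blk x = y'' then (1 : ℝ) else 0) * T₀ μ x) ^ 2 :=
        Finset.sum_congr rfl fun x _ => by rw [hind x]
      rw [e]
      exact hT₀ y'' y' (fun x => if blk x = y'' then (1 : ℝ) else 0) μ 1 zero_le_one
        (fun x => by by_cases hx : blk x = y'' <;> simp [hx]) (fun x hx => by simp [hx]) hμ0
    · exact mul_nonneg (mul_nonneg (mul_nonneg (mul_nonneg (mul_nonneg hcv hΛ) hAW) hHh) zero_le_one) (Real.exp_nonneg _)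
  -- the `y″`-sum ([4] (2.61))
  have hsum : ∑ y'' : g.Site, Real.sqrt (∑ x, (hf x * W (blockPiece (g := toB6 g R H) blk y'' (T₀ μ)) x) ^ 2) ≤
      A₀ * Hh * (cv * Λ * AW) * B6.c1 d δ₀ β * Real.exp (-(ρ'' * g.dist y y')) * Real.sqrt (∑ x, μ x ^ 2) := by
    refine (Finset.sum_le_sum fun y'' _ => hpiece y'').trans ?_
    have hweak : ∀ y'' : g.Site, cv * Λ * AW * Hh * 1 * Real.exp (-(ρ' * g.dist y y'')) *
        (A₀ * 1 * Real.exp (-(r * g.dist y'' y')) * Real.sqrt (∑ x, μ x ^ 2)) ≤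
        A₀ * Hh * (cv * Λ * AW) * Real.sqrt (∑ x, μ x ^ 2) *
          (((1 : ℝ) * Real.exp (-(ρ' * g.dist y y''))) * ((1 : ℝ) * Real.exp (-(ρ'' * g.dist y'' y')))) := by
      intro y''
      have hx := exp_rate_mono hρ''r (hdnn y'' y')
      have hpre : 0 ≤ cv * Λ * AW * Hh * Real.exp (-(ρ' * g.dist y y'')) * A₀ * Real.sqrt (∑ x, μ x ^ 2) := by positivity
      calc cv * Λ * AW * Hh * 1 * Real.exp (-(ρ' * g.dist y y'')) * (A₀ * 1 * Real.exp (-(r * g.dist y'' y')) * Real.sqrt (∑ x, μ x ^ 2))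
          = (cv * Λ * AW * Hh * Real.exp (-(ρ' * g.dist y y'')) * A₀ * Real.sqrt (∑ x, μ x ^ 2)) * Real.exp (-(r * g.dist y'' y')) := by ring
        _ ≤ (cv * Λ * AW * Hh * Real.exp (-(ρ' * g.dist y y'')) * A₀ * Real.sqrt (∑ x, μ x ^ 2)) * Real.exp (-(ρ'' * g.dist y'' y')) :=
            mul_le_mul_of_nonneg_left hx hpre
        _ = A₀ * Hh * (cv * Λ * AW) * Real.sqrt (∑ x, μ x ^ 2) *
              (((1 : ℝ) * Real.exp (-(ρ' * g.dist y y''))) * ((1 : ℝ) * Real.exp (-(ρ'' * g.dist y'' y')))) := by ring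
    refine (Finset.sum_le_sum fun y'' _ => hweak y'').trans ?_
    rw [← Finset.mul_sum]
    have hρ''ρ'2 : ρ'' + (0 + β) * δ₀ ≤ ρ' := by linarith
    have hconv := conv_le (R := R) (H := H) d δ₀ 0 β ρ'' ρ' 1 (fun _ => (1 : ℝ)) (fun _ => (1 : ℝ)) (fun _ => zero_le_one)
      (fun _ => zero_le_one) zero_le_one hρ'' hρ''ρ'2 hdnn htri (scaleTransfer_one (by rw [zero_mul]) hdnn) h261 y y'
    have hpre : 0 ≤ A₀ * Hh * (cv * Λ * AW) * Real.sqrt (∑ x, μ x ^ 2) :=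
      mul_nonneg (mul_nonneg (mul_nonneg hA₀ hHh) (mul_nonneg (mul_nonneg hcv hΛ) hAW)) hN
    refine (mul_le_mul_of_nonneg_left hconv hpre).trans (le_of_eq ?_)
    ring
  calc Real.sqrt (∑ x, (hf x * E μ x) ^ 2)
      ≤ A₀ * Hh * Real.exp (-(ρ'' * g.dist y y')) * Real.sqrt (∑ x, μ x ^ 2) +
          A₀ * Hh * (cv * Λ * AW) * B6.c1 d δ₀ β * Real.exp (-(ρ'' * g.dist y y')) * Real.sqrt (∑ x, μ x ^ 2) :=
        hmain.trans (add_le_add h1 hsum)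
    _ = (A₀ * (1 + cv * Λ * AW * B6.c1 d δ₀ β)) * Hh * Real.exp (-(ρ'' * g.dist y y')) * Real.sqrt (∑ x, μ x ^ 2) := by ring

end Device

/-! ## §5  THEOREM 3.4 × THEOREM 3.1: THE `L²` MEMBER (3.46)₆ (TWO RIGHT DIFFERENCES) FOR THE CONCRETE `G′(U′U)` OF (3.64), PRINTED QUANTIFIERS -/

section FinalGp

variable {𝔸 : Type*} [NormedRing 𝔸] [NormedAlgebra ℂ 𝔸] [CompleteSpace 𝔸] {ι : Type} [Fintype ι]
variable (b : Module.Basis ι ℝ 𝔸) {S : Type} {κ : Type} [Fintype κ]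
variable (T : κ → Equiv.Perm S) (U : κ → S → 𝔸ˣ)
variable {g : B9.Geometry} [Fintype g.Site] {Rr : ℝ} {H : Prop}

set_option maxHeartbeats 1600000 in
/-- **THEOREM 3.4 × THEOREM 3.1: THE `L²` MEMBER (3.46)₆ `‖hG′∇*_U∇*_Uλ‖ ≦ B₀|h|e^{−δ₀d(y,y′)}‖λ‖` FOR THE CONCRETE `G′(U′U)` OF (3.64)** (for `U′U` by
Theorem 3.4 p. 400 «The extended operators satisfy all the inequalities of Theorems 3.1–3.3 correspondingly» and p. 403 l. 2–9).  HYPOTHESES = FILE 16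
`thm34_Gp_kernel_final` VERBATIM + the block volumes `hvol` + [4] Lemma 2.1 for `v^{−1/2}` (`hSTv`) (as FILES 39/40) + NEW: (3.46)₆ FOR `G′(U)` as an `L²`
block input for every pair of concrete first differences ON THE RIGHT (`h346`, constant `B₄₆`; p. 398 «the choice of derivatives ∇_U, ∇*_U is conventional»:
the letters `∇_k = conj b (diffLetter η⁻¹ k)`, `k ∈ κ ⊕ κ`, cover both orientations).  CONCLUSION `∃ a₁ > 0 ∃ B ≧ 0 ∀ α₁ ≦ a₁ ∀ A kF sF …` (FILE 16's
premises verbatim): `G′(U′U)` is the two-sided inverse of `Δ′_a(U) − V′(A)` ∧ `∀ k m ∀ y y′ ∀ h` (`|h| ≦ H`, `supp h ⊂ Δ(y)`) `∀ λ` (`supp λ ⊂ Δ(y′)`):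
`‖h·G′(U′U)∇_k∇_mλ‖₂ ≦ BHe^{−(19δ₀/25)d(y,y′)}‖λ‖₂`.  PROOF: the SECOND equality of (3.65) p. 402 «G′(U′U) = G′(U) + G′(U′U)V′(A)G′(U)»
(`resolvent_right` on `Δ′_a(U)G′(U) = 1`, `G′(U′U)(Δ′_a(U) − V′(A)) = 1`) gives `G′(U′U)∇∇ = G′(U)∇∇ + [G′(U′U)V′(A)]·(G′(U)∇∇)`; the right factor carries
(3.46)₆ FOR `U` (the input `h346`), the left factor `W = G′(U′U)V′(A)` — `V′(A)` ON THE RIGHT — carries the KERNEL bound of §3 fed with FILE 16's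
kernel entries (3.42)₁,₃ of `G′(U′U)` (rate `4δ₀/5`) and the column bounds of §2 for the concrete letters; `Θ(α₁) ≦ K` below a threshold by continuity
(«of course with different constants», p. 403); then §4.  `B = B₄₆(1 + c_vΛ_v·(Λ_v²Λc₁(δ₀,1/100)·B₁₆·K)·c₁(δ₀,1/100))`, rate cascade
`4δ₀/5 → 39δ₀/50 → 77δ₀/100 → 19δ₀/25`.  HONEST SCOPE: module header.
[cite: Balaban1985BackgroundPropagators, Thm 3.4 p.400 + Thm 3.1 (3.46) p.398 + p.398 remarks + (3.60)–(3.65) p.402 + p.403 l.2–9 + p.393 + (3.37) p.396 + (3.52) p.400; Balaban1985RegularSpaces, (1.87) p.91; Balaban1984PropagatorsII, (2.51)–(2.55) p.232 + (2.64)–(2.66) p.234 + Lemma 2.1 p.234] -/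
theorem thm34_Gp_l2_right_final [Fintype S] [DecidableEq S] [DecidableEq ι] [DecidableEq g.Site] [Nonempty g.Site] (blk : S → g.Site) (d : ℕ)
    (δ₀ BG Cq a₀ d₀ M₂ : ℝ)
    (kQ : g.Site → S → 𝔸 →L[ℝ] 𝔸) (sQ : S → 𝔸 →L[ℝ] 𝔸) (cfun w : g.Site → ℝ)
    (hBG : 0 < BG) (hCq : 0 ≤ Cq) (ha₀ : 0 ≤ a₀) (hM₂ : 0 ≤ M₂) (hδ₀ : 0 < δ₀)
    -- the multiscale geometry 𝔅 (p. 393, [4] (2.1)–(2.4)) and its axioms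
    (hdnn : ∀ a a' : g.Site, 0 ≤ g.dist a a') (htri : Triangle254 (toB6 g Rr H)) (hrefl : ∀ y : g.Site, g.dist y y = 0)
    (hsym : ∀ y y' : g.Site, g.dist y y' = g.dist y' y) (hlen : ∀ y : g.Site, 0 < g.len y) (hlenη : ∀ y : g.Site, g.eta ≤ g.len y)
    (hη : 0 < g.eta)
    -- [4] Lemma 2.1 (2.61) at the rate `δ₀`, «for every 0 < α < 1», and the p. 398 scale transfer for every exponent
    (h261 : ∀ α : ℝ, 0 < α → α < 1 → Ineq261 d (toB6 g Rr H) δ₀ α)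
    (hST : ∀ α : ℝ, 0 < α → ∃ Λ : ℝ, 1 ≤ Λ ∧ ScaleTransfer g δ₀ α Λ (fun a => g.len a) ∧ ScaleTransfer g δ₀ α Λ (fun a => g.len a ^ 2) ∧
      ScaleTransfer g δ₀ α Λ (fun a => (g.len a)⁻¹) ∧ ScaleTransfer g δ₀ α Λ (fun a => (g.len a ^ 2)⁻¹) ∧
      ScaleTransfer g δ₀ α Λ (fun a => (g.len a ^ 4)⁻¹) ∧ ScaleTransfer g δ₀ α Λ (fun y => g.len y ^ (-(4 : ℝ))))
    (hrepr : ∀ (v : 𝔸) (i : ι), |b.repr v i| ≤ M₂ * ‖v‖)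
    (hU1 : ∀ m z, ‖((U m z : 𝔸ˣ) : 𝔸)‖ ≤ 1 ∧ ‖(((U m z)⁻¹ : 𝔸ˣ) : 𝔸)‖ ≤ 1)
    (hd₀B : ∀ μ x, g.dist (blk x) (blk ((T μ).symm x)) ≤ d₀) (hd₀F : ∀ μ x, g.dist (blk x) (blk (T μ x)) ≤ d₀)
    (hd₀0 : ∀ y : g.Site, g.dist y y ≤ d₀)
    -- the `A`-independent data of the concrete `V′(A)` of (3.60)
    (hw : ∀ y, 0 ≤ w y) (hcard : ∀ y, ((B9Eq360Vprime.block blk y).card : ℝ) * w y ≤ 1)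
    (hkQ : ∀ y x, blk x = y → ‖kQ y x‖ ≤ w y) (hsQ : ∀ x, ‖sQ x‖ ≤ 1) (hcfun : ∀ y, |cfun y| ≤ a₀ * (g.len y ^ 2)⁻¹)
    -- THEOREM 3.1 for `G′(U)`: (3.24) `G′(U) = (Δ′_a(U))⁻¹` for the letter `Δ′_a(U)`, and (3.42)₁,₂,₃ at the rate `δ₀`
    {Δp Gp : Module.End ℝ (S × ι → ℝ)} (hΔpGp : Δp * Gp = 1) (hGpΔp : Gp * Δp = 1)
    (h342_1 : HasMajorant (g := toB6 g Rr H) (fun p : S × ι => blk p.1) Gp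
      (fun a a' => BG * g.len a ^ 2 * Real.exp (-(δ₀ * g.dist a a'))))
    (h342_2 : ∀ k : κ ⊕ κ, HasMajorant (g := toB6 g Rr H) (fun p : S × ι => blk p.1)
      (conj b (diffLetter T U ((g.eta : ℂ)⁻¹) k) * Gp) (fun a a' => BG * g.len a * Real.exp (-(δ₀ * g.dist a a'))))
    (h342_3 : ∀ k : κ ⊕ κ, HasMajorant (g := toB6 g Rr H) (fun p : S × ι => blk p.1)
      (Gp * conj b (diffLetter T U ((g.eta : ℂ)⁻¹) k)) (fun a a' => BG * g.len a * Real.exp (-(δ₀ * g.dist a a'))))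
    -- the kernel pairing of p. 393 (`c = η^d`, block volume weight `v(y′) = (L^{j′}η)^d`) and THEOREM 3.1's (3.42)₁₋₄ FOR `G′(U)` IN THE PRINTED KERNEL FORM
    {v : g.Site → ℝ} (hv : ∀ y, 0 < v y) {cK : ℝ} (hcK : 0 < cK)
    (hGpk : HasKernelBound (g := toB6 g Rr H) (fun p : S × ι => blk p.1) v cK Gp
      (fun a a' => BG * g.len a ^ 2 * Real.exp (-(δ₀ * g.dist a a'))))
    (hDGpk : ∀ k : κ ⊕ κ, HasKernelBound (g := toB6 g Rr H) (fun p : S × ι => blk p.1) v cK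
      (conj b (diffLetter T U ((g.eta : ℂ)⁻¹) k) * Gp) (fun a a' => BG * g.len a * Real.exp (-(δ₀ * g.dist a a'))))
    (hGpDk : ∀ l : κ ⊕ κ, HasKernelBound (g := toB6 g Rr H) (fun p : S × ι => blk p.1) v cK
      (Gp * conj b (diffLetter T U ((g.eta : ℂ)⁻¹) l)) (fun a a' => BG * g.len a * Real.exp (-(δ₀ * g.dist a a'))))
    (hDGpDk : ∀ k l : κ ⊕ κ, HasKernelBound (g := toB6 g Rr H) (fun p : S × ι => blk p.1) v cK
      (conj b (diffLetter T U ((g.eta : ℂ)⁻¹) k) * Gp * conj b (diffLetter T U ((g.eta : ℂ)⁻¹) l)) (fun a a' => BG * Real.exp (-(δ₀ * g.dist a a'))))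
    -- the block volumes in the kernel pairing (p. 393) and [4] Lemma 2.1 for the block-volume weight `v^{−1/2}` (p. 398 remark), as FILES 39/40
    (cv : ℝ) (hvol : ∀ y : g.Site, cK * ((Finset.univ.filter (fun p : S × ι => blk p.1 = y)).card : ℝ) ≤ cv * v y)
    (hSTv : ∀ α : ℝ, 0 < α → ∃ Λ : ℝ, 1 ≤ Λ ∧ ScaleTransfer g δ₀ α Λ (fun y => (Real.sqrt (v y))⁻¹))
    -- NEW: THEOREM 3.1's (3.46)₆ FOR `G′(U)` in `L²` block form («‖hG′(U)∇*_U∇*_Uλ‖ ≦ B₀·1·|h|e^{−δ₀d(y,y′)}‖λ‖»), every pair of concrete first differences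
    (B46 : ℝ) (hB46 : 0 ≤ B46)
    (h346 : ∀ (k m : κ ⊕ κ) (y y'' : g.Site) (hf ν : S × ι → ℝ) (Hh : ℝ), 0 ≤ Hh → (∀ x, |hf x| ≤ Hh) → (∀ x, blk x.1 ≠ y → hf x = 0) →
      (∀ x, blk x.1 ≠ y'' → ν x = 0) →
      Real.sqrt (∑ x, (hf x * (Gp * (conj b (diffLetter T U ((g.eta : ℂ)⁻¹) k)) * (conj b (diffLetter T U ((g.eta : ℂ)⁻¹) m))) ν x) ^ 2) ≤ B46 * Hh * Real.exp (-(δ₀ * g.dist y y'')) * Real.sqrt (∑ x, ν x ^ 2)) :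
    ∃ a₁ : ℝ, 0 < a₁ ∧ ∃ B : ℝ, 0 ≤ B ∧
    ∀ (α₁ : ℝ), 0 ≤ α₁ → α₁ ≤ a₁ →
    -- the exponent field `A` in the domain (3.37), read blockwise, and the `A`-dependent (3.59) data `kF`, `sF`
    ∀ (A : κ → S → 𝔸) (kF : g.Site → S → 𝔸 →L[ℝ] 𝔸) (sF : S → 𝔸 →L[ℝ] 𝔸),
      (∀ y x, blk x = y → ‖kF y x‖ ≤ Cq * α₁ * w y) → (∀ x, ‖sF x‖ ≤ Cq * α₁) →
      (∀ ν k x, ‖((g.eta : ℂ)⁻¹) • covDstar T U ν (A k) x‖ ≤ α₁ * (g.len (blk x) ^ 2)⁻¹) →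
      (∀ μ ν x, ‖((g.eta : ℂ)⁻¹) • covD T U μ (A ν) x‖ ≤ α₁ * (g.len (blk x) ^ 2)⁻¹) →
      (∀ μ x, ‖((g.eta : ℂ)⁻¹) • covDstar T U μ (tauB T U μ (A μ)) x‖ ≤ α₁ * (g.len (blk x) ^ 2)⁻¹) →
      (∀ k x, ‖A k x‖ ≤ α₁ * (g.len (blk x))⁻¹) → (∀ ν k x, ‖tauB T U ν (A k) x‖ ≤ α₁ * (g.len (blk x))⁻¹) →
      -- (i) `G′(U′U)` = the two-sided inverse of `Δ′_a(U) − V′(A)` (FILE 16/26, re-exported)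
      (Δp - (conj b (vPrimeConc T U g.eta A blk kQ kF sQ sF cfun))) * (gPrimeExtEnd Gp (conj b (vPrimeConc T U g.eta A blk kQ kF sQ sF cfun) * Gp)) = 1 ∧
      (gPrimeExtEnd Gp (conj b (vPrimeConc T U g.eta A blk kQ kF sQ sF cfun) * Gp)) * (Δp - (conj b (vPrimeConc T U g.eta A blk kQ kF sQ sF cfun))) = 1 ∧
      -- (viii″) NEW: the `L²` member (3.46)₆ of Theorem 3.1 for `G′(U′U)`, every pair of concrete first differences on the RIGHT
      (∀ (k m : κ ⊕ κ) (y y' : g.Site) (hf μ : S × ι → ℝ) (Hh : ℝ), 0 ≤ Hh → (∀ x, |hf x| ≤ Hh) → (∀ x, blk x.1 ≠ y → hf x = 0) →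
        (∀ x, blk x.1 ≠ y' → μ x = 0) →
        Real.sqrt (∑ x, (hf x * ((gPrimeExtEnd Gp (conj b (vPrimeConc T U g.eta A blk kQ kF sQ sF cfun) * Gp)) * (conj b (diffLetter T U ((g.eta : ℂ)⁻¹) k)) * (conj b (diffLetter T U ((g.eta : ℂ)⁻¹) m))) μ x) ^ 2) ≤
          B * Hh * Real.exp (-(19 / 25 * δ₀ * g.dist y y')) * Real.sqrt (∑ x, μ x ^ 2)) := by
  classical
  obtain ⟨y₀⟩ := ‹Nonempty g.Site›
  -- FILE 16: thresholds, the constant `B₁₆`, the two inverse identities and the four kernel entries of `G′(U′U)` at the rate `4δ₀/5`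
  obtain ⟨a₁, ha₁, B', hB', H16⟩ := thm34_Gp_kernel_final (Rr := Rr) (H := H) b T U blk d δ₀ BG Cq a₀ d₀ M₂ kQ sQ cfun w hBG hCq ha₀ hM₂ hδ₀
    hdnn htri hrefl hsym hlen hlenη hη h261 hST hrepr hU1 hd₀B hd₀F hd₀0 hw hcard hkQ hsQ hcfun hΔpGp hGpΔp h342_1 h342_2 h342_3 hv hcK hGpk hDGpk
    hGpDk hDGpDk
  -- the p. 398 scale transfers at exponent `1/100`: the weights `(Lʲη)⁻¹`, `(Lʲη)⁻²` and the block-volume weight `v^{−1/2}`; [4] Lemma 2.1 at `β = 1/100`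
  obtain ⟨Λ, hΛ1, -, -, hT1i, hT2i, -, -⟩ := hST (1 / 100) (by norm_num)
  have hΛ0 : 0 ≤ Λ := zero_le_one.trans hΛ1
  obtain ⟨Λv, hΛv1, hTv⟩ := hSTv (1 / 100) (by norm_num)
  have hΛv0 : 0 ≤ Λv := zero_le_one.trans hΛv1
  have h261β : Ineq261 d (toB6 g Rr H) δ₀ (1 / 100) := h261 _ (by norm_num) (by norm_num)
  have hc1 : 0 ≤ B6.c1 d δ₀ (1 / 100) := B6RandomWalk.c1_nonneg d δ₀ (1 / 100)
  -- the block-volume weight `v⁻¹` moves at the rate `δ₀/50` with the constant `Λ_v²` (square of [4] Lemma 2.1 for `v^{−1/2}`)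
  have hTv2 : ∀ a a' : g.Site, Real.exp (-(1 / 50 * δ₀ * g.dist a a')) * (v a)⁻¹ ≤ Λv ^ 2 * (v a')⁻¹ := by
    intro a a'
    have h1 := hTv a' a
    rw [hsym a' a] at h1
    have hs : 0 ≤ Real.exp (-(1 / 100 * δ₀ * g.dist a a')) * (Real.sqrt (v a))⁻¹ :=
      mul_nonneg (Real.exp_nonneg _) (inv_nonneg.mpr (Real.sqrt_nonneg _))
    have h2 := mul_le_mul h1 h1 hs ((hs.trans h1))
    have e1 : Real.exp (-(1 / 100 * δ₀ * g.dist a a')) * (Real.sqrt (v a))⁻¹ * (Real.exp (-(1 / 100 * δ₀ * g.dist a a')) * (Real.sqrt (v a))⁻¹)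
        = Real.exp (-(1 / 50 * δ₀ * g.dist a a')) * (v a)⁻¹ := by
      have hsq : (Real.sqrt (v a))⁻¹ * (Real.sqrt (v a))⁻¹ = (v a)⁻¹ := by
        rw [← mul_inv, Real.mul_self_sqrt (hv a).le]
      calc Real.exp (-(1 / 100 * δ₀ * g.dist a a')) * (Real.sqrt (v a))⁻¹ * (Real.exp (-(1 / 100 * δ₀ * g.dist a a')) * (Real.sqrt (v a))⁻¹)
          = (Real.exp (-(1 / 100 * δ₀ * g.dist a a')) * Real.exp (-(1 / 100 * δ₀ * g.dist a a'))) * ((Real.sqrt (v a))⁻¹ * (Real.sqrt (v a))⁻¹) := by ring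
        _ = Real.exp (-(1 / 50 * δ₀ * g.dist a a')) * (v a)⁻¹ := by
            rw [hsq, ← Real.exp_add]; congr 2; ring
    have e2 : Λv * (Real.sqrt (v a'))⁻¹ * (Λv * (Real.sqrt (v a'))⁻¹) = Λv ^ 2 * (v a')⁻¹ := by
      have hsq : (Real.sqrt (v a'))⁻¹ * (Real.sqrt (v a'))⁻¹ = (v a')⁻¹ := by
        rw [← mul_inv, Real.mul_self_sqrt (hv a').le]
      calc Λv * (Real.sqrt (v a'))⁻¹ * (Λv * (Real.sqrt (v a'))⁻¹) = Λv ^ 2 * ((Real.sqrt (v a'))⁻¹ * (Real.sqrt (v a'))⁻¹) := by ring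
        _ = Λv ^ 2 * (v a')⁻¹ := by rw [hsq]
    rw [e1, e2] at h2
    exact h2
  -- «of course with different constants» (p. 403): the `α₁`-dependent constant `Θ(α₁)` of §3 is continuous in `α₁`, hence `≦ K` below a threshold `ε`
  obtain ⟨K, ε, hK, hε, hKb⟩ := exists_bound_of_continuousAt
    (f := fun α₁ : ℝ => (Fintype.card ι * M₂ * ∑ i, ‖b i‖) * Real.exp ((39 / 50 * δ₀ + 1 / 50 * δ₀) * d₀) * α₁ *
      (4 * Fintype.card κ + ((1 + 2 * Fintype.card κ) * ((2 + 8 * (1 : ℝ) ^ 2 * α₁) * Fintype.card κ) + a₀ * Cq * (2 + Cq * α₁)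
        + 4 * Fintype.card κ * (1 : ℝ) ^ 2)))
    (by fun_prop)
  -- the constant of the kernel of `W = G′(U′U)V′(A)` and the final constant
  set AW : ℝ := Λv ^ 2 * Λ * B6.c1 d δ₀ (1 / 100) * B' * K with hAW
  have hAW0 : 0 ≤ AW := by rw [hAW]; positivity
  have hcv : 0 ≤ cv := by
    have h4 : 0 ≤ cK * ((Finset.univ.filter (fun p : S × ι => blk p.1 = y₀)).card : ℝ) := by positivity
    have h0 : 0 * v y₀ ≤ cv * v y₀ := by rw [zero_mul]; exact h4.trans (hvol y₀)
    exact le_of_mul_le_mul_right h0 (hv y₀)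
  refine ⟨min a₁ (min (ε / 2) (1 / 4)), lt_min ha₁ (lt_min (half_pos hε) (by norm_num)),
    B46 * (1 + cv * Λv * AW * B6.c1 d δ₀ (1 / 100)), by positivity, ?_⟩
  intro α₁ hα₁0 hα₁1 A kF sF hkF hsF h337B h337F h337Bτ hA hAτB
  have hα₁a : α₁ ≤ a₁ := hα₁1.trans (min_le_left _ _)
  have hα₁ε : α₁ ≤ ε / 2 := hα₁1.trans ((min_le_right _ _).trans (min_le_left _ _))
  have hα₁q : α₁ ≤ 1 / 4 := hα₁1.trans ((min_le_right _ _).trans (min_le_right _ _))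
  obtain ⟨i1, i2, k1, -, k3, -⟩ := H16 α₁ hα₁0 hα₁a A kF sF hkF hsF h337B h337F h337Bτ hA hAτB
  have hθK : (Fintype.card ι * M₂ * ∑ i, ‖b i‖) * Real.exp ((39 / 50 * δ₀ + 1 / 50 * δ₀) * d₀) * α₁ *
      (4 * Fintype.card κ + ((1 + 2 * Fintype.card κ) * ((2 + 8 * (1 : ℝ) ^ 2 * α₁) * Fintype.card κ) + a₀ * Cq * (2 + Cq * α₁)
        + 4 * Fintype.card κ * (1 : ℝ) ^ 2)) ≤ K :=
    hKb α₁ (by rw [abs_of_nonneg hα₁0]; linarith)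
  -- the shapes in which §3 reads (3.37), the transports and the stencil geometry
  have hsmall : ∀ y : g.Site, g.eta * (α₁ * (g.len y)⁻¹) ≤ 1 / 4 := fun y => by
    have hq : g.eta * (g.len y)⁻¹ ≤ 1 := by
      rw [← div_eq_mul_inv]; exact (div_le_one (hlen y)).mpr (hlenη y)
    calc g.eta * (α₁ * (g.len y)⁻¹) = α₁ * (g.eta * (g.len y)⁻¹) := by ring
      _ ≤ α₁ * 1 := mul_le_mul_of_nonneg_left hq hα₁0
      _ ≤ 1 / 4 := by linarith
  have hA' : ∀ μ x, ‖A μ x‖ ≤ α₁ * (g.len (blk x))⁻¹ ∧ ‖tauB T U μ (A μ) x‖ ≤ α₁ * (g.len (blk x))⁻¹ :=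
    fun μ x => ⟨hA μ x, hAτB μ μ x⟩
  have h337s' : ∀ μ x, ‖((g.eta : ℂ)⁻¹) • covDstar T U μ (A μ) x‖ ≤ α₁ * (g.len (blk x) ^ 2)⁻¹ := fun μ x => h337B μ μ x
  have h337F' : ∀ μ x, ‖((g.eta : ℂ)⁻¹) • covD T U μ (A μ) x‖ ≤ α₁ * (g.len (blk x) ^ 2)⁻¹ := fun μ x => h337F μ μ x
  have hd₀' : ∀ μ x, g.dist (blk x) (blk (T μ x)) ≤ d₀ ∧ g.dist (blk x) (blk ((T μ).symm x)) ≤ d₀ :=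
    fun μ x => ⟨hd₀F μ x, hd₀B μ x⟩
  -- abbreviations
  set V' : Module.End ℝ (S × ι → ℝ) := conj b (vPrimeConc T U g.eta A blk kQ kF sQ sF cfun) with hV'
  set GE : Module.End ℝ (S × ι → ℝ) := gPrimeExtEnd Gp (V' * Gp) with hGE
  -- FILE 16's kernel entries (3.42)₁,₃ of `G′(U′U)` in the weight shapes §3 reads (`w_T = (Lʲη)²`, `w_T·(Lʲη)⁻¹ = Lʲη`)
  have hl21 : ∀ a : g.Site, g.len a ^ 2 * (g.len a)⁻¹ = g.len a := fun a => by
    rw [pow_two, mul_assoc, mul_inv_cancel₀ (hlen a).ne', mul_one]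
  have hl22 : ∀ a : g.Site, g.len a ^ 2 * (g.len a ^ 2)⁻¹ = 1 := fun a => mul_inv_cancel₀ (pow_ne_zero 2 (hlen a).ne')
  have k3' : ∀ l : κ ⊕ κ, HasKernelBound (g := toB6 g Rr H) (fun p : S × ι => blk p.1) v cK (GE * conj b (diffLetter T U ((g.eta : ℂ)⁻¹) l))
      (fun a a' => B' * (g.len a ^ 2 * (g.len a)⁻¹) * Real.exp (-(4 / 5 * δ₀ * g.dist a a'))) := fun l =>
    hasKernelBound_mono (g := toB6 g Rr H) _ hv (k3 l) fun a a' => le_of_eq (by rw [hl21])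
  -- §3: the kernel of `W = G′(U′U)·V′(A)` (V′ on the RIGHT) at the rate `39δ₀/50` (`ρ + (1/100 + 1/100)δ₀ ≦ 4δ₀/5`), weight `(Lʲη)²·(Lʲη)⁻² = 1`
  have hr : 39 / 50 * δ₀ + (1 / 100 + 1 / 100) * δ₀ ≤ 4 / 5 * δ₀ := by linarith
  have hW0 := hasKernelBound_mul_vPrime_right (Rr := Rr) (H := H) b T U blk d hη A kQ kF sQ sF cfun w 1 d₀ M₂ Cq a₀ δ₀ (4 / 5 * δ₀) (1 / 100) (1 / 100)
    (1 / 50 * δ₀) (39 / 50 * δ₀) Λ (Λv ^ 2) B' α₁ (fun a => g.len a ^ 2) hv hcK hB' hα₁0 hΛ0 (by positivity) (by linarith) (by linarith) hr hdnn htri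
    hlen h261β (fun a => sq_nonneg _) hT1i hT2i hTv2 hM₂ hrepr hsmall hA' h337s' h337F' h337Bτ hU1 hd₀' hd₀0 hw hcard hCq ha₀ hkQ hkF hsQ hsF hcfun
    (Tr := GE) k1 k3'
  have hW : HasKernelBound (g := toB6 g Rr H) (fun p : S × ι => blk p.1) v cK (GE * V') (fun a a' => AW * Real.exp (-(39 / 50 * δ₀ * g.dist a a'))) := by
    refine hasKernelBound_mono (g := toB6 g Rr H) _ hv hW0 fun a a' => ?_
    rw [hl22, mul_one]
    refine mul_le_mul_of_nonneg_right ?_ (Real.exp_nonneg _)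
    have e39 : (39 / 50 * δ₀ + 1 / 50 * δ₀) = (39 / 50 * δ₀ + 1 / 50 * δ₀) := rfl
    have hpre : 0 ≤ Λv ^ 2 * Λ * B6.c1 d δ₀ (1 / 100) * B' := by positivity
    calc Λv ^ 2 * Λ * B6.c1 d δ₀ (1 / 100) * B' * ((Fintype.card ι * M₂ * ∑ i, ‖b i‖) * Real.exp ((39 / 50 * δ₀ + 1 / 50 * δ₀) * d₀) * α₁ *
          (4 * Fintype.card κ + ((1 + 2 * Fintype.card κ) * ((2 + 8 * (1 : ℝ) ^ 2 * α₁) * Fintype.card κ) + a₀ * Cq * (2 + Cq * α₁)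
            + 4 * Fintype.card κ * (1 : ℝ) ^ 2)))
        ≤ Λv ^ 2 * Λ * B6.c1 d δ₀ (1 / 100) * B' * K := mul_le_mul_of_nonneg_left hθK hpre
      _ = AW := by rw [hAW]
  -- (3.65)₂ in resolvent form, from the two inverse identities: `G′(U′U) = G′(U) + G′(U′U)·V′(A)·G′(U)`
  have hres : GE = Gp + GE * V' * Gp := resolvent_right (Δa := Δp) (V := V') (G := Gp) (GExt := GE) hΔpGp i2
  refine ⟨i1, i2, fun k m y y' hf μ Hh hHh hh hh0 hμ0 => ?_⟩
  -- `E = G′(U′U)∇_k∇_m = T₀ + W·T₀` with `T₀ = G′(U)∇_k∇_m`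
  have hE : GE * conj b (diffLetter T U ((g.eta : ℂ)⁻¹) k) * conj b (diffLetter T U ((g.eta : ℂ)⁻¹) m) =
      Gp * conj b (diffLetter T U ((g.eta : ℂ)⁻¹) k) * conj b (diffLetter T U ((g.eta : ℂ)⁻¹) m) +
        (GE * V') * (Gp * conj b (diffLetter T U ((g.eta : ℂ)⁻¹) k) * conj b (diffLetter T U ((g.eta : ℂ)⁻¹) m)) := by
    conv_lhs => rw [hres]
    simp only [add_mul, mul_assoc]
  -- rates of §4: `ρ = 39δ₀/50` (kernel of W), `ρ′ = 77δ₀/100` (Schur transfer of `v^{−1/2}` at `1/100`), `ρ″ = 19δ₀/25` ([4] (2.61) at `1/100`), `r = δ₀`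
  have hρ'ρ : 77 / 100 * δ₀ + 1 / 100 * δ₀ ≤ 39 / 50 * δ₀ := by linarith
  have hρ''ρ' : 19 / 25 * δ₀ + 1 / 100 * δ₀ ≤ 77 / 100 * δ₀ := by linarith
  have hρ''r : 19 / 25 * δ₀ ≤ δ₀ := by linarith
  exact l2_right_transfer (R := Rr) (H := H) (fun p : S × ι => blk p.1) hv hcK hvol d hB46 hAW0 (by linarith) hρ'ρ hρ''ρ' hρ''r hdnn htri
    h261β hTv hE (h346 k m) hW y y' hf μ Hh hHh hh hh0 hμ0

end FinalGp

end Literature.MathematicalPhysics.QuantumFieldTheory.Balaban1983to89.B9Ineq346L2RightDiff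

end
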